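import Literature.ComputerArithmetic.BoldoMuller2005.Successor
import Literature.ComputerArithmetic.RumpOgitaOishi2008.NextPowerTwo
import Mathlib.Tactic.Linarith
import Mathlib.Tactic.Positivity
import Mathlib.Tactic.Ring
import Mathlib.Tactic.FieldSimp
import Mathlib.Tactic.LinearCombination

/-!
# Rump–Zimmermann–Boldo–Melquiond, *Computing predecessor and successor in rounding to nearest*
# — Algorithms 1 and 2, Theorems 1–3, and the enclosure (22)

Siegfried M. Rump, Paul Zimmermann, Sylvie Boldo, Guillaume Melquiond, *Computing predecessor and
successor in rounding to nearest*, BIT Numerical Mathematics 49(2) (2009) 419–431,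
doi 10.1007/s10543-009-0218-z; author version HAL inria-00337537 (the text held as
`paper:doi-10-1007-s10543-009-0218-z`, 11 pp.; page numbers below are those of that version).
[cite: RumpZimmermannBoldoMelquiond2009]

Typed for the engines group (unit `eng-cap-1`; HONEST FRAMING: shared numerical engines serving
client cells; rigour lives in the verifiers; every published number belongs to a client cell's
ledger, not to the engines group) as part of the cap kernel lane's literature base on EXACTLY
ROUNDED binary arithmetic: how the floating-point neighbours `pred(c)`, `succ(c)` — the IEEE 754-2008
operations `nextDown` / `nextUp`, which an interval kernel uses to round outward — are obtained, or
rigorously bounded, using only operations rounded TO NEAREST, and why `[cinf, csup]` then encloses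
`a ∘ b`. Only the printed mathematics is formalised; no claim about any program is made in this file.

## The text being formalised (author version pp. 2–8)

(p. 2) "The floating-point predecessor and successor of a real number `x ∈ ℝ` are defined by
`pred(x) := max{f ∈ F : f < x}` and `succ(x) := min{f ∈ F : x < f}` […]."
(p. 3) "We use the 'unit in the first place' […] `ufp(x) := β^⌊log_β|x|⌋` for `x ≠ 0`. […] Define
`U := {f ∈ F : |f| < (β/2)u⁻¹η}` (7). […] Note that `½u⁻¹η` is the smallest positive normal
floating-point number. For positive `c ∈ F` such that `succ(c)` is finite […]:
if `c ∈ U`: `pred(c) = c − η`, `succ(c) = c + η` (8);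
if `c ∉ U`, `c ≠ β^k`: `pred(c) = c − 2u ufp(c)`, `succ(c) = c + 2u ufp(c)` (9);
if `c ∉ U`, `c = β^k`: `pred(c) = c − (2/β)u ufp(c)`, `succ(c) = c + 2u ufp(c)` (10).
Moreover, define […] `M⁻(c) := ½(pred(c) + c)` and `M⁺(c) := ½(c + succ(c))` (11). It follows for
`c ∈ F`, `x ∈ ℝ`: `x < M⁻(c) ⇒ fl(x) ≤ pred(c)`, `M⁺(c) < x ⇒ succ(c) ≤ fl(x)`,
`M⁻(c) < x ⇒ c ≤ fl(x)`, `x < M⁺(c) ⇒ fl(x) ≤ c` (12).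

**2.1 General radix β.** For `c ∈ F` consider the following algorithm.
**Algorithm 1** (Bounds for predecessor and successor of finite `c ∈ F` in rounding to nearest)
`e = fl(fl(φ|c|) + η)`  % `φ = u(1 + (4/β)u) = succ(u)`;  `cinf = fl(c − e)`;  `csup = fl(c + e)`.
Note that we need a reasonable floating-point format to ensure that `φ` is a floating-point number.
More precisely, we need `η ≤ 2u²` […].
**Theorem 1.** Let finite `c ∈ F` be given, and assume `u ≤ β⁻²/2`. Let `cinf` and `csup` be the
quantities computed by Algorithm 1. Then `cinf ≤ pred(c)` and `succ(c) ≤ csup` (13)."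
(p. 4, the proof) "We first prove that for `e` as computed in Algorithm 1 we have `e > u ufp(c)`
(14). […] By (9) and (10) we know `c − u ufp(c) ≤ M⁻(c)` and `M⁺(c) = c + u ufp(c)`, so (14) and
(12) yield `c − e < M⁻(c)` and `M⁺(c) < c + e` (17) and prove (13)."

(p. 5) "**2.2 Binary arithmetic.** In this section we assume `β = 2`, thus `u` is a power of two,
and `φ = u(1 + 2u) = succ(u)`. […]
**Theorem 2.** Assume binary arithmetic, i.e., `β = 2`, with at least 4 bits of precision, i.e.,
`u ≤ ¹⁄₁₆`. Assume the rounding is 'ties to even', or 'ties to away' as defined by IEEE 754-2008.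
Then for all finite `c ∈ F` with `|c| ∉ [½, 2]u⁻¹η` the quantities `cinf` and `csup` computed by
Algorithm 1 satisfy `cinf = pred(c)` and `succ(c) = csup` (18).
*Remark 1.* For IEEE 754 binary64 format the excluded range `[½, 2]u⁻¹η` is `[2⁻¹⁰²², 2⁻¹⁰²⁰]`,
which corresponds to two binades around the subnormal threshold. In this range Algorithm 1 returns
`cinf = pred(pred(c))` and `csup = succ(succ(c))`, i.e., it is one bit off.
*Remark 2.* It is easy to see from the proof that when `u ≤ ¹⁄₃₂`, the assertions remain true for
any tie-breaking rule in rounding to nearest."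
(pp. 5–6, the proof) "If `c < ½u⁻¹η`, then […] `fl(φc) = 0`. Hence `e = η` […]. It remains to
prove (18) for `c > 2u⁻¹η`. We first show `e ≤ (5/2)u ufp(c)` (19). […]
`φc = u(1 + 2u)c < 2u(1 + u)ufp(c) =: (1 + u)C` (20) […] `c' = fl(φc) ≤ C` in both cases […].
Third, assume `c = ¼u⁻²η`. Then `φc = uc + ½η`, and this is the only case where the tie-breaking
rule is important. If the computation of `fl(φc)` is rounded to nearest with ties to even, then
`c' = fl(φc) = uc` and the proof of the second case holds. Let us finally assume rounding to nearest
with 'ties to away'. Then […] `c' = uc + η` and `e = uc + 2η`. Hence `csup = fl(c + e) = succ(c)`.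
Finally, `u ≤ ¹⁄₁₆` and rounding ties to away implies `cinf = fl(c − e) = pred(c)`. […]
We mention that the assumption `u ≤ ¹⁄₁₆` is necessary to prove the inequalities in (13) to be
equalities. This is seen by `u = ⅛`, `η = ¹⁄₃₂` and `c = 1 ∉ [½, 2]u⁻¹η = [⅛, ½]`."

(p. 7) "Given `a, b ∈ F`, rigorous and mostly sharp bounds for `a ∘ b`, `∘ ∈ {+, −, ×, ÷}` can be
computed by applying Algorithm 1 to `c := fl(a ∘ b)`. This holds for the square root as well. […]
**Algorithm 2** (Computation of the predecessor and successor of finite `c ∈ F` in binary arithmetic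
with rounding to nearest)
`if |c| ≥ ½u⁻²η then e = fl(φ|c|); cinf = fl(c − e); csup = fl(c + e)`
`elseif |c| < u⁻¹η: cinf = fl(c − η); csup = fl(c + η)`
`else C = fl(u⁻¹c); e = fl(φ|C|); cinf = fl(fl(C − e)·u); csup = fl(fl(C + e)·u)`.
**Theorem 3.** Let finite `c ∈ F` be given in binary radix, and let `cinf, csup ∈ F` be the
quantities computed by Algorithm 2. Assume `u ≤ ¹⁄₁₆`, and that `½u⁻³η` does not cause overflow.
Then `cinf = pred(c)` and `succ(c) = csup` (21)."
(p. 8) "Algorithms 1 and 2 may be used to bound the true value of an operation `∘ ∈ {+, −, ×, ÷}`: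
If `c = fl(a ∘ b)`, then `cinf ≤ a ∘ b ≤ csup` (22) for `cinf, csup` computed by Algorithm 1 or 2."

## Model and reading (the dictionary)

Radix 2 throughout (the binary case `β = 2` of Algorithm 1 / Theorem 1, and all of §2.2), precision
`p`, minimal exponent `emin`, NO upper exponent bound, over `ℚ`: the float set is `IsFloat p emin`
(`x = M·2^e`, `|M| < 2^p`, `emin ≤ e`) of `Literature.ComputerArithmetic.JeannerodRump2018.Summation`,
"rounding to nearest" is ANY map `fl` with `IsRoundNearest p emin fl` (a float, at least as near as
every float; NO tie rule fixed), "ties to even" is the explicit function `roundTiesEven p emin` of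
`Literature.ComputerArithmetic.BoldoJeannerodMelquiondMuller2023.RoundToNearestEven`, and "ties to
away" is the 2-line predicate `IsTiesAway` below (an equally near float is never larger in
magnitude). `u = unitRoundoff p = 2^-p`; `η = 2^emin` (smallest positive subnormal); `½u⁻¹η =
2^(emin+p-1)` (smallest positive normal); `u⁻¹η = 2^(emin+p)`, so `U = {|f| < 2^(emin+p)}`;
`2u⁻¹η = 2^(emin+p+1)`; `½u⁻²η = 2^(emin+2p-1)`; `¼u⁻²η = 2^(emin+2p-2)`; `ufp` is
`RumpOgitaOishi2008.ufp`; `pred(c) = P` / `succ(c) = S` are the relations `IsPred p emin c P` /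
`IsSucc p emin c S` of `RumpOgitaOishi2008.AccSum` (so "`cinf ≤ pred(c)`" reads `cinf ≤ P` for THE
`P` with `IsPred c P`, which exists and is unique, `exists_isPred`); `φ = phi p = u(1 + 2u)`, proved
equal to Boldo–Muller's `succConst p` (`phi_eq_succConst`; the paper's reference [1]).
Because exponents are unbounded above, "finite `c`", "`succ(c)` finite" and "`½u⁻³η` does not cause
overflow" are vacuous here and every statement is about ALL of `F`; the underflow side (subnormals,
`η`, the set `U`, the excluded binades of Theorem 2) is modelled exactly. The midpoints `M±` are
written out (`(P + c)/2`, `(c + S)/2`); (8) is `isPred_sub_eta_and_isSucc_add_eta_of_abs_lt` (proved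
here on all of `U`), (9)/(10) are `isSucc_add_two_u_ufp`, `isPred_sub_two_u_ufp`, `isPred_two_zpow`
and (12) is `fl_le_of_lt_mid_succ` / `le_fl_of_mid_pred_lt` of `RumpOgitaOishi2009.NearSum` (the
paper's reference [6] is Rump–Ogita–Oishi, *Accurate floating-point summation I*).

NEAREST IN-TREE NOTIONS (R-407(b4) dedup record): (a) `BoldoMuller2005/Successor.lean` types the
paper's reference [1] — the fma-based `succ(x) = ◦(x + ◦(s|x|))`-type formulas with the SAME constant
`s = 2^-p + 2^(1-2p)` (`succConst`, = `φ` here), valid for NORMAL `x` with an fma (Properties 7–9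
there); the present paper removes the fma (two roundings, `fl(fl(φ|c|) + η)`), adds `η` so that
Theorem 1 holds on all of `F` including subnormals, proves EQUALITY outside `[½, 2]u⁻¹η` (Theorem 2)
and everywhere for Algorithm 2 (Theorem 3), and draws the enclosure (22); (b) `RumpOgitaOishi2009/
NearSum.lean` supplies the neighbour/midpoint lemmas (8)–(12) used here but no algorithm computing
neighbours; (c) no statement of Algorithms 1–2, Theorems 1–3, (19) or (22), and no occurrence of this
DOI or title, exists elsewhere under `Literature/` or `Summits/` (queries in the submission record);
(d) "ties to away": `Literature/` has the function `roundTiesEven` but no ties-to-away notion (RN_a is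
only quoted, in `RoundToNearestEven.lean`'s header: "the one with largest magnitude"); a TIES-UPWARD
predicate `TiesUp` ("every float at least as near lies below `fl t`"; = ties-to-away for `t ≥ 0` only)
exists Summits-side in `Summits/Ventures/CertifiedArithmetic/LowPrec/OptChainLabelsTiesAway.lean`,
not importable here — hence the 2-line magnitude predicate `IsTiesAway` below, used only by
`theorem_2_tiesAway`.

## What is proved (0 `sorry`, axioms `propext`, `Classical.choice`, `Quot.sound` only; binary, `IsFloat p emin` over `ℚ`)

* Definitions: `phi`, `stepE` (`e`), `cinf`, `csup`, `algorithm1`; `stepE2`, `scaleC`, `algorithm2`;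
  `IsTiesAway`. Facts: `phi_eq_succConst`, `isFloat_phi` (`φ ∈ F` iff-direction `emin ≤ 1 − 2p`,
  i.e. `η ≤ 2u²`), (8) on `U`: `isPred_sub_eta_and_isSucc_add_eta_of_abs_lt`.
* THEOREM 1 (binary case), for EVERY `c ∈ F`, every round-to-nearest `fl`, every `p ≥ 2`:
  `theorem_1 : IsPred c P → IsSucc c S → cinf ≤ P ∧ S ≤ csup`, via `eta_le_stepE` (`e ≥ η`) and the
  key inequality (14) `u_mul_ufp_lt_stepE : 2^(emin+p) ≤ |c| → u·ufp(c) < e`. (The printed hypothesis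
  `u ≤ β⁻²/2`, i.e. `p ≥ 3` in binary, is only needed for `β > 2`; in binary `p ≥ 2` suffices and is
  what we assume.)
* THEOREM 2 (`p ≥ 4`, `|c| < 2^(emin+p-1) ∨ 2^(emin+p+1) < |c|`): `theorem_2_low` (the subnormal
  side, `e = η`: `stepE_eq_eta`, any `p ≥ 1`, any tie rule); on the large side (19)
  `stepE_le_five_halves_u_ufp : e ≤ (5/2)u·ufp(c)` with (20) `fl_phi_le_two_u_ufp : c' ≤ C = 2u ufp(c)`,
  the `csup` half `abs_add_stepE_lt_mid`, the two special `cinf` cases `stepE_le_two_u_ufp_of_eq`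
  (`|c| = ufp(c)(1 + 2u)`: `e ≤ 2u ufp(c)`) and `stepE_le_of_abs_eq_two_zpow` (`|c| = 2^E`:
  `e ≤ (5/4)u|c|`, the three printed sub-cases, the tie case under the hypothesis that THIS tie is
  rounded down), assembled in `mid_lt_abs_sub_stepE` and `theorem_2_high`. The printed theorem is then
  obtained in the three forms it asserts: `theorem_2` (any round-to-nearest whose tie
  `fl(2^(emin+2) + ½η)` at `p = 4` goes to the even side `2^(emin+2)` — vacuous for `p ≥ 5`),
  `theorem_2_tiesEven` (`fl = roundTiesEven p emin`, the tie discharged by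
  `roundTiesEven_tie_prec_four`), `theorem_2_tiesAway` (any round-to-nearest with `IsTiesAway`; the
  tie-sensitive input `p = 4`, `|c| = ¼u⁻²η = 2^(emin+6)` is `theorem_2_prec_four_tie_point_of_tiesAway`,
  both signs, incl. the second tie `|c| − e = M⁻(pred|c|)` of the printed argument); and REMARK 2 as
  `theorem_2_of_five_le` (`p ≥ 5`, ANY tie rule). Also `theorem_2_high_of_le` (`|c| ≥ ½u⁻²η`, any
  tie rule, `p ≥ 4` — the form used by Theorem 3).
* SHARPNESS of `u ≤ ¹⁄₁₆` — the paper's own witness `u = ⅛`, `η = ¹⁄₃₂`, `c = 1`, DECIDED: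
  `theorem_2_fails_prec_three : algorithm1 (roundTiesEven 3 (-5)) 3 (-5) 1 = (3/4, 5/4)` while
  `pred(1) = 7/8` (and `succ(1) = 5/4`): `cinf = pred(pred(1))`.
* THEOREM 3 / ALGORITHM 2 (`p ≥ 4`, ANY tie rule — the "if"-threshold `½u⁻²η` keeps the tie point
  `¼u⁻²η` out of the first branch, so no tie hypothesis is needed, as printed): `theorem_3 :
  IsPred c (algorithm2 c).1 ∧ IsSucc c (algorithm2 c).2` for every `c ∈ F`, from `theorem_3_if`
  (`e ≥ u·succ|c| > u ufp(c)` and `e ≤ e'`), the exact `±η` branch, and the scaling branch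
  (`scaleC = 2^p c` exactly, `isPred_div_two_pow` / `isSucc_div_two_pow`, `isFloat_div_two_pow`).
* (22): `enclosure_algorithm1 : cinf(fl x) < x < csup(fl x)` (`p ≥ 2`) and `enclosure_algorithm2`
  (`p ≥ 4`), for every rational `x` (so for `x = a ∘ b`, `∘ ∈ {+, −, ×, ÷}`, whenever `c = fl(a ∘ b)`),
  via `pred_fl_lt` / `lt_succ_fl`.

## Not typed

General radix `β > 2` (Theorem 1 for `β ≠ 2`, the radix-10 worst case of Fig. 1, `φ = u(1 + (4/β)u)`);
eqs. (1), (4), (5) and the width comparison of Fig. 2; the fma Remark after Theorem 1 (`e₀ = fl(φ|c| +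
η)`); Remark 1's description of the excluded range as a universal statement (READING NOTE: Theorem 1
still gives `cinf ≤ pred(c)`, `succ(c) ≤ csup` there; an exhaustive check at `p = 4, 5, 6` over the two
excluded binades finds inputs where Algorithm 1 is exact as well as inputs where it is one bit off, so
"returns `pred(pred(c))`" describes the worst case, not every `c`, and is recorded here only as prose);
the overflow clauses (vacuous in the model, see above); the discussion (23) of a universal factor `φ'`
and its four counterexamples; the C implementation and the timings of §2.2/§3; decimal formats.

## Informal link to the cap kernel (no formal claim)

The cap kernel's interval legs round outward with the host's `nextafter` (i.e. `nextDown`/`nextUp` of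
binary64 = `pred`/`succ` at `p = 53`, `emin = −1074`); this paper is the reference analysis of these
neighbour functions in round-to-nearest-only arithmetic — Theorem 3: Algorithm 2 computes exactly
`pred(c)`, `succ(c)` for every finite `c`; Theorems 1–2: the branch-free Algorithm 1 bounds them, with
equality outside `[2⁻¹⁰²², 2⁻¹⁰²⁰]`; (22): either yields an enclosure of `a ∘ b` from `c = fl(a ∘ b)`.
Whether any program realises these algorithms is not asserted here.
-/

namespace Literature.ComputerArithmetic.RumpZimmermannBoldoMelquiond2009

open Literature.ComputerArithmetic.JeannerodRump2018
open Literature.ComputerArithmetic.BoldoJeannerodMelquiondMuller2023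
open Literature.ComputerArithmetic.RumpOgitaOishi2008
open Literature.ComputerArithmetic.RumpOgitaOishi2009 (isSucc_of_isPred isPred_of_isSucc isPred_neg_iff
  isSucc_neg_iff isSucc_add_two_u_ufp isPred_sub_two_u_ufp isPred_two_zpow fl_le_of_lt_mid_succ
  le_fl_of_mid_pred_lt isFloat_add_two_u_ufp_of_threshold_le)
open Literature.ComputerArithmetic.JoldesMullerPopescu2017 (isFloat_two_zpow)
open Literature.ComputerArithmetic.BoldoMuller2005 (succConst succConst_eq isFloat_succConst)

variable {p : ℕ} {emin : ℤ} {fl : ℚ → ℚ}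

/-! ### §2 Definitions and basic facts: `u`, `η`, `φ = u(1 + 2u) = succ(u)`, Algorithm 1 -/

/-- The constant `φ := u(1 + 2u) = succ(u)` of Algorithm 1 in binary (`u = 2^-p` the relative rounding
error unit; general radix: `φ = u(1 + (4/β)u)`).
[cite: RumpZimmermannBoldoMelquiond2009, §2.1 Algorithm 1; §2.2 ("`φ = u(1 + 2u) = succ(u)`")] -/
def phi (p : ℕ) : ℚ := unitRoundoff p * (1 + 2 * unitRoundoff p)

/-- `φ = u + 2u² = 2^-p + 2^(1-2p)` is the constant `s` of Boldo–Muller's fma-based successor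
(the paper's reference [1]). [cite: RumpZimmermannBoldoMelquiond2009, §2.1 Algorithm 1 ("`φ = succ(u)`")] -/
theorem phi_eq_succConst (p : ℕ) : phi p = succConst p := by
  rw [phi, succConst_eq, unitRoundoff, one_div, ← zpow_natCast, ← zpow_neg]
  ring

/-- `φ > 0`. [folklore] -/
private theorem phi_pos (p : ℕ) : 0 < phi p := by
  have := u_pos (p := p); unfold phi; positivity

/-- `φ ∈ F` in every "reasonable" format: `η ≤ 2u²`, i.e. `emin ≤ 1 − 2p` ("we need a reasonable
floating-point format to ensure that `φ` is a floating-point number. More precisely, we need `η ≤ 2u²`").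
[cite: RumpZimmermannBoldoMelquiond2009, §2.1 (note after Algorithm 1)] -/
theorem isFloat_phi (hp : 2 ≤ p) (hemin : emin ≤ 1 - 2 * (p : ℤ)) : IsFloat p emin (phi p) := by
  rw [phi_eq_succConst]; exact isFloat_succConst hp hemin

/-- The quantity `e` of ALGORITHM 1: `e = fl(fl(φ|c|) + η)`, `η = 2^emin` the smallest positive
subnormal. [cite: RumpZimmermannBoldoMelquiond2009, §2.1 Algorithm 1] -/
def stepE (fl : ℚ → ℚ) (p : ℕ) (emin : ℤ) (c : ℚ) : ℚ :=
  fl (fl (phi p * |c|) + (2 : ℚ) ^ emin)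

/-- ALGORITHM 1, first result: `cinf = fl(c − e)`. [cite: RumpZimmermannBoldoMelquiond2009, §2.1 Algorithm 1] -/
def cinf (fl : ℚ → ℚ) (p : ℕ) (emin : ℤ) (c : ℚ) : ℚ := fl (c - stepE fl p emin c)

/-- ALGORITHM 1, second result: `csup = fl(c + e)`. [cite: RumpZimmermannBoldoMelquiond2009, §2.1 Algorithm 1] -/
def csup (fl : ℚ → ℚ) (p : ℕ) (emin : ℤ) (c : ℚ) : ℚ := fl (c + stepE fl p emin c)

/-- ALGORITHM 1 (`[cinf, csup]`, three additions/subtractions and one multiplication, all rounded to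
nearest). [cite: RumpZimmermannBoldoMelquiond2009, §2.1 Algorithm 1] -/
def algorithm1 (fl : ℚ → ℚ) (p : ℕ) (emin : ℤ) (c : ℚ) : ℚ × ℚ :=
  (cinf fl p emin c, csup fl p emin c)

/-- `e(−c) = e(c)`: Algorithm 1 only sees `|c|`. [folklore] -/
private theorem stepE_neg (c : ℚ) : stepE fl p emin (-c) = stepE fl p emin c := by simp [stepE, abs_neg]

/-! ### Auxiliary facts of the model -/

/-- `2^k > 0` in `ℚ`. [folklore] -/
private theorem two_zpow_pos' (k : ℤ) : (0 : ℚ) < (2 : ℚ) ^ k := zpow_pos (by norm_num) k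

/-- A rounding to nearest maps `|x| < η/2` to `0`.
[cite: RumpZimmermannBoldoMelquiond2009, §2.2 (proof of Theorem 2, first case: "`φc ≤ ½(1 + 2u)η − u(1 + 2u)η < ½η` implies `fl(φc) = 0`")] -/
theorem fl_eq_zero_of_abs_lt_half_eta (hfl : IsRoundNearest p emin fl) {x : ℚ}
    (hx : |x| < (2 : ℚ) ^ emin / 2) : fl x = 0 := by
  have h0 : IsFloat p emin 0 := ⟨0, emin, by simp, le_rfl, by simp⟩
  have hmin := (hfl x).2 0 h0
  rw [sub_zero] at hmin
  have h1 : |fl x| < (2 : ℚ) ^ emin := by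
    have : |fl x| ≤ |x - fl x| + |x| := by
      rw [show fl x = x - (x - fl x) by ring, abs_sub_comm x (x - (x - fl x))]
      simpa using abs_sub_le (x - (x - fl x)) x 0 |>.trans (by simp [abs_sub_comm])
    linarith
  exact eq_zero_of_isFloat_of_abs_lt (hfl x).1 h1

/-- (8): in `U = {f ∈ F : |f| < (β/2)u⁻¹η}`, i.e. for `β = 2` exactly `|f| < u⁻¹η = 2^(emin+p)` (the
subnormal numbers together with the first normal binade), consecutive floats are `η` apart: `f ± η ∈ F`,
`pred(f) = f − η`, `succ(f) = f + η`. [cite: RumpZimmermannBoldoMelquiond2009, §2 eqs. (7)–(8)] -/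
theorem isPred_sub_eta_and_isSucc_add_eta_of_abs_lt (hp : 1 ≤ p) {f : ℚ} (hf : IsFloat p emin f)
    (hU : |f| < (2 : ℚ) ^ (emin + p)) :
    IsPred p emin f (f - (2 : ℚ) ^ emin) ∧ IsSucc p emin f (f + (2 : ℚ) ^ emin) := by
  have h2 := two_zpow_pos' emin
  obtain ⟨N, hN⟩ := hf.exists_int_mul_zpow_emin
  have hNabs : |(N : ℚ)| < (2 : ℚ) ^ p := by
    have h1 : |(N : ℚ)| * (2 : ℚ) ^ emin < (2 : ℚ) ^ p * (2 : ℚ) ^ emin := by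
      rw [← abs_of_pos h2, ← abs_mul, abs_of_pos h2, ← hN, ← zpow_natCast,
        ← zpow_add₀ (by norm_num : (2 : ℚ) ≠ 0), add_comm]
      exact hU
    exact lt_of_mul_lt_mul_right h1 h2.le
  have hNabs' : |N| < (2 : ℤ) ^ p := by
    have : |(N : ℚ)| < ((2 ^ p : ℤ) : ℚ) := by push_cast; exact hNabs
    rw [← Int.cast_abs] at this; exact_mod_cast this
  have hF : ∀ s : ℤ, |s| ≤ 1 → IsFloat p emin (f + s * (2 : ℚ) ^ emin) := by
    intro s hs
    have h1 : |N + s| ≤ (2 : ℤ) ^ p := (abs_add_le _ _).trans (by omega)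
    have := isFloat_of_abs_le (emin := emin) hp h1 le_rfl
    rw [hN]; push_cast at this ⊢; convert this using 1; ring
  have hFm := hF (-1) (by simp)
  have hFp := hF 1 (by simp)
  simp only [Int.cast_neg, Int.cast_one, neg_mul, one_mul, ← sub_eq_add_neg] at hFm hFp
  refine ⟨⟨hFm, by linarith, fun h hh hhf => le_sub_eta_of_lt hf hh hhf⟩,
    ⟨hFp, by linarith, fun h hh hfh => ?_⟩⟩
  have := le_sub_eta_of_lt hh hf hfh
  linarith

/-- `η ∈ F`. [folklore] -/
private theorem isFloat_eta (hp : 1 ≤ p) : IsFloat p emin ((2 : ℚ) ^ emin) := isFloat_two_zpow hp le_rfl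

/-- The exponent of a float of magnitude `≥ 2^K` is at least `K`: `K ≤ log₂ ufp`. [folklore] -/
private theorem le_log_of_two_zpow_le {c : ℚ} {K : ℤ} (hK : (2 : ℚ) ^ K ≤ |c|) : K ≤ Int.log 2 |c| := by
  by_contra h
  push Not at h
  have h1 := abs_lt_zpow_log_succ c
  have h2 : (2 : ℚ) ^ (Int.log 2 |c| + 1) ≤ (2 : ℚ) ^ K := zpow_le_zpow_right₀ (by norm_num) (by omega)
  linarith

/-! ### §2.1 Theorem 1: `cinf ≤ pred(c)` and `succ(c) ≤ csup` for every `c ∈ F` -/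

/-- `e ≥ η`: `c' = fl(φ|c|) ≥ 0`, so `c' + η ≥ η ∈ F`. [cite: RumpZimmermannBoldoMelquiond2009, §2.1
(proof of Theorem 1, the case `c ∈ U`)] -/
theorem eta_le_stepE (hp : 1 ≤ p) (hfl : IsRoundNearest p emin fl) (c : ℚ) :
    (2 : ℚ) ^ emin ≤ stepE fl p emin c := by
  unfold stepE
  have hc' : 0 ≤ fl (phi p * |c|) := fl_nonneg hfl (by have := phi_pos p; positivity)
  exact le_fl_of_le hfl (isFloat_eta hp) (by linarith)

/-- `c' = fl(φ|c|) ≤ e`.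
[cite: RumpZimmermannBoldoMelquiond2009, §2.1 (proof of (14): "`e = fl(c' + η) ≥ c'`")] -/
theorem fl_phi_le_stepE (hfl : IsRoundNearest p emin fl) (c : ℚ) :
    fl (phi p * |c|) ≤ stepE fl p emin c := by
  unfold stepE
  exact le_fl_of_le hfl (hfl _).1 (by linarith [two_zpow_pos' emin])

/-- **(14): `e > u·ufp(c)` for `c ∉ U`** (here: `|c| ≥ u⁻¹η = 2^(emin+p)`), by the case distinction of the
printed proof (`ufp(c)·succ(u)` representable or not; in the latter case `c' ≥ u·ufp(c) ∈ F` and either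
`c' + η` is exact or `c' ≥ u⁻¹η`). Valid for every precision `p ≥ 2` and every `emin` (the printed
standing assumption is `p ≥ 3`, `η ≤ 2u²·…`; see the module docstring).
[cite: RumpZimmermannBoldoMelquiond2009, §2.1 eq. (14) and its proof] -/
theorem u_mul_ufp_lt_stepE (hp : 2 ≤ p) (hfl : IsRoundNearest p emin fl) {c : ℚ}
    (hcU : (2 : ℚ) ^ (emin + p) ≤ |c|) : unitRoundoff p * ufp c < stepE fl p emin c := by
  have hp1 : 1 ≤ p := by omega
  have h2ne : (2 : ℚ) ≠ 0 := by norm_num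
  have hc0 : c ≠ 0 := by
    rintro rfl; simp at hcU; linarith [two_zpow_pos' (emin + p)]
  set E : ℤ := Int.log 2 |c| with hE
  have hufp : ufp c = (2 : ℚ) ^ E := ufp_of_ne_zero hc0
  have hEle : (2 : ℚ) ^ E ≤ |c| := zpow_log_le_abs hc0
  have hEge : emin + p ≤ E := le_log_of_two_zpow_le hcU
  have hu : unitRoundoff p * (2 : ℚ) ^ E = (2 : ℚ) ^ (E - p) := u_mul_two_zpow E
  have hupos := u_pos (p := p)
  have hφ := phi_pos p
  -- `c' ≤ e`
  have hce := fl_phi_le_stepE hfl c (p := p) (emin := emin)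
  rw [hufp, hu]
  by_cases hA : emin ≤ E + 1 - 2 * p
  · -- `φ·ufp(c) = (2^(p-1) + 1)·2^(E+1-2p) ∈ F`, so `c' ≥ φ·ufp(c) > u·ufp(c)`
    have hφE : phi p * (2 : ℚ) ^ E = (((2 : ℤ) ^ (p - 1) + 1 : ℤ) : ℚ) * (2 : ℚ) ^ (E + 1 - 2 * p) := by
      rw [phi, unitRoundoff]
      have hp' : (2 : ℚ) ^ p = 2 ^ (p - 1) * 2 := by rw [← pow_succ]; congr 1; omega
      push_cast
      rw [show E + 1 - 2 * (p : ℤ) = E + (1 - 2 * (p : ℤ)) by ring, zpow_add₀ h2ne,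
        show (1 : ℤ) - 2 * (p : ℤ) = -(p : ℤ) + -(p : ℤ) + 1 by ring, zpow_add_one₀ h2ne,
        zpow_add₀ h2ne, zpow_neg, zpow_natCast, hp']
      field_simp
    have hφF : IsFloat p emin (phi p * (2 : ℚ) ^ E) := by
      rw [hφE]
      refine isFloat_of_abs_le hp1 ?_ hA
      have h1 : (0 : ℤ) < 2 ^ (p - 1) := by positivity
      have hp' : (2 : ℤ) ^ p = 2 ^ (p - 1) * 2 := by rw [← pow_succ]; congr 1; omega
      rw [abs_of_pos (by omega)]; omega
    have hc' : phi p * (2 : ℚ) ^ E ≤ fl (phi p * |c|) :=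
      le_fl_of_le hfl hφF (mul_le_mul_of_nonneg_left hEle hφ.le)
    have hgt : (2 : ℚ) ^ (E - p) < phi p * (2 : ℚ) ^ E := by
      rw [← hu, phi]
      have h2E := two_zpow_pos' E
      have : 0 < 2 * unitRoundoff p * unitRoundoff p * (2 : ℚ) ^ E := by positivity
      nlinarith
    linarith
  · push Not at hA
    -- `u·ufp(c) = 2^(E-p) ∈ F` and `c' ≥ u·ufp(c)`
    have huF : IsFloat p emin ((2 : ℚ) ^ (E - p)) := isFloat_two_zpow hp1 (by omega)
    have hc' : (2 : ℚ) ^ (E - p) ≤ fl (phi p * |c|) := by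
      refine le_fl_of_le hfl huF ?_
      rw [← hu, phi]
      have h1 : unitRoundoff p * (2 : ℚ) ^ E ≤ unitRoundoff p * |c| := mul_le_mul_of_nonneg_left hEle hupos.le
      have h2 : 0 ≤ 2 * unitRoundoff p * unitRoundoff p * |c| := by positivity
      nlinarith
    by_cases hB : |fl (phi p * |c|)| < (2 : ℚ) ^ (emin + p)
    · -- `c' + η ∈ F`: `e = c' + η > c' ≥ u·ufp(c)`
      have hF := (isPred_sub_eta_and_isSucc_add_eta_of_abs_lt hp1 (hfl _).1 hB).2.1
      have : stepE fl p emin c = fl (phi p * |c|) + (2 : ℚ) ^ emin := by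
        unfold stepE; exact fl_eq_self hfl hF
      rw [this]
      linarith [two_zpow_pos' emin]
    · -- `c' ≥ u⁻¹η = 2^(emin+p) > 2^(E-p)` since `E ≤ emin + 2p - 2`
      push Not at hB
      have hc'0 : 0 ≤ fl (phi p * |c|) := fl_nonneg hfl (by positivity)
      rw [abs_of_nonneg hc'0] at hB
      have : (2 : ℚ) ^ (E - p) < (2 : ℚ) ^ (emin + p) := zpow_lt_zpow_right₀ (by norm_num) (by omega)
      linarith

/-- **THEOREM 1.** For every floating-point number `c` the quantities `cinf`, `csup` computed by
Algorithm 1 satisfy `cinf ≤ pred(c)` and `succ(c) ≤ csup` — for every precision `p ≥ 2`, every `emin`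
and every rounding to nearest `fl` (any tie rule). [cite: RumpZimmermannBoldoMelquiond2009, §2.1 Theorem 1] -/
theorem theorem_1 (hp : 2 ≤ p) (hfl : IsRoundNearest p emin fl) {c : ℚ} (hc : IsFloat p emin c)
    {cp cs : ℚ} (hcp : IsPred p emin c cp) (hcs : IsSucc p emin c cs) :
    cinf fl p emin c ≤ cp ∧ cs ≤ csup fl p emin c := by
  have hp1 : 1 ≤ p := by omega
  have hη := eta_le_stepE hp1 hfl c (p := p) (emin := emin)
  unfold cinf csup
  set e := stepE fl p emin c with he
  rcases lt_or_ge |c| ((2 : ℚ) ^ (emin + p)) with hU | hU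
  · -- `c ∈ U`: `pred(c) = c − η ≥ c − e`, `succ(c) = c + η ≤ c + e`
    have h8 := isPred_sub_eta_and_isSucc_add_eta_of_abs_lt hp1 hc hU
    rw [hcp.unique h8.1, hcs.unique h8.2]
    exact ⟨fl_le_of_le hfl h8.1.1 (by linarith), le_fl_of_le hfl h8.2.1 (by linarith)⟩
  · -- `c ∉ U`: (14) and (17)
    have h14 := u_mul_ufp_lt_stepE hp hfl hU
    have hU' : (2 : ℚ) ^ (emin + p - 1) < |c| :=
      lt_of_lt_of_le (zpow_lt_zpow_right₀ (by norm_num) (by omega)) hU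
    obtain ⟨hlo, -, hhi⟩ := pred_succ_within_two_u_ufp hp1 hc hU' hcp hcs
    constructor
    · exact fl_le_of_lt_mid_succ hfl hcp.1 (isSucc_of_isPred hcp hc) (by linarith)
    · exact le_fl_of_mid_pred_lt hfl hcs.1 (isPred_of_isSucc hcs hc) (by linarith)


/-! ### Small exponent helpers -/

/-- Monotonicity of `2^k`. [folklore] -/
private theorem two_zpow_le_two_zpow {a b : ℤ} (h : a ≤ b) : (2 : ℚ) ^ a ≤ (2 : ℚ) ^ b :=
  zpow_le_zpow_right₀ (by norm_num) h

/-- Strict monotonicity of `2^k`. [folklore] -/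
private theorem two_zpow_lt_two_zpow_iff {a b : ℤ} : (2 : ℚ) ^ a < (2 : ℚ) ^ b ↔ a < b :=
  zpow_lt_zpow_iff_right₀ (by norm_num)

/-- `2^k = 2^n · 2^m` whenever `k = m + n`. [folklore] -/
private theorem two_zpow_shift (k m : ℤ) (n : ℕ) (h : k = m + n) : (2 : ℚ) ^ k = 2 ^ n * (2 : ℚ) ^ m := by
  subst h; rw [zpow_add₀ (by norm_num : (2 : ℚ) ≠ 0), zpow_natCast, mul_comm]

/-- Congruence of `2^k` in the exponent. [folklore] -/
private theorem two_zpow_congr {a b : ℤ} (h : a = b) : (2 : ℚ) ^ a = (2 : ℚ) ^ b := by rw [h]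

/-- The binade data of a nonzero `c`: `ufp(c) = 2^E ≤ |c| < 2^(E+1)` with `E = ⌊log₂|c|⌋`.
[cite: RumpZimmermannBoldoMelquiond2009, §2 eq. (6) ("`ufp(x) ≤ |x| < β ufp(x)`")] -/
theorem ufp_spec {c : ℚ} (hc0 : c ≠ 0) :
    ufp c = (2 : ℚ) ^ Int.log 2 |c| ∧ (2 : ℚ) ^ Int.log 2 |c| ≤ |c| ∧
      |c| < (2 : ℚ) ^ (Int.log 2 |c| + 1) :=
  ⟨ufp_of_ne_zero hc0, zpow_log_le_abs hc0, abs_lt_zpow_log_succ c⟩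

/-- `u = 2^-p ≤ 2^-k` for `p ≥ k`. [folklore] -/
private theorem u_le_of_le {k : ℕ} (hk : k ≤ p) : unitRoundoff p ≤ 1 / 2 ^ k :=
  one_div_le_one_div_of_le (by positivity) (pow_le_pow_right₀ (by norm_num) hk)

/-! ### §2.2 Theorem 2: equality outside `[½u⁻¹η, 2u⁻¹η]` -/

/-- The range below `½u⁻¹η`: for `c ∈ F` with `|c| < 2^(emin+p-1)` one has `|c| ≤ 2^(emin+p-1) − η`,
hence `φ|c| < η/2`, `c' = fl(φ|c|) = 0` and `e = fl(η) = η`.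
[cite: RumpZimmermannBoldoMelquiond2009, §2.2 (proof of Theorem 2, first case: "If `c < ½u⁻¹η`, then
`c ≤ ½u⁻¹η − η` by (8), so that `φc ≤ […] < η` implies `fl(φc) = 0`. Hence `e = η`")] -/
theorem stepE_eq_eta (hp : 1 ≤ p) (hfl : IsRoundNearest p emin fl) {c : ℚ} (hc : IsFloat p emin c)
    (hlt : |c| < (2 : ℚ) ^ (emin + p - 1)) : stepE fl p emin c = (2 : ℚ) ^ emin := by
  have hF : IsFloat p emin ((2 : ℚ) ^ (emin + p - 1)) := isFloat_two_zpow hp (by omega)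
  have hle : |c| ≤ (2 : ℚ) ^ (emin + p - 1) - (2 : ℚ) ^ emin := le_sub_eta_of_lt hF (isFloat_abs hc) hlt
  set u := unitRoundoff p with hu
  set H : ℚ := (2 : ℚ) ^ (emin - 1) with hH
  have hupos : 0 < u := u_pos
  have hHpos : 0 < H := two_zpow_pos' _
  have huH : u * (2 : ℚ) ^ (emin + p - 1) = H := by
    rw [hu, u_mul_two_zpow, hH]; exact two_zpow_congr (by ring)
  have hη : (2 : ℚ) ^ emin = 2 * H := by rw [hH, two_zpow_shift emin (emin - 1) 1 (by ring), pow_one]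
  have hsmall : abs (phi p * |c|) < (2 : ℚ) ^ emin / 2 := by
    rw [abs_of_nonneg (by have := phi_pos p; positivity), hη]
    calc phi p * |c| ≤ phi p * ((2 : ℚ) ^ (emin + p - 1) - (2 : ℚ) ^ emin) :=
          mul_le_mul_of_nonneg_left hle (phi_pos p).le
      _ = (1 + 2 * u) * (u * (2 : ℚ) ^ (emin + p - 1)) - u * (1 + 2 * u) * (2 : ℚ) ^ emin := by
          rw [phi, ← hu]; ring
      _ = H - 4 * u * u * H := by rw [huH, hη]; ring
      _ < 2 * H / 2 := by have := mul_pos (mul_pos hupos hupos) hHpos; linarith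
  have hc' : fl (phi p * |c|) = 0 := fl_eq_zero_of_abs_lt_half_eta hfl hsmall
  unfold stepE
  rw [hc', zero_add]
  exact fl_eq_self hfl (isFloat_eta hp)

/-- **THEOREM 2, the range `|c| < ½u⁻¹η`**: there `e = η` and `cinf = c − η = pred(c)`,
`csup = c + η = succ(c)` exactly (every `p ≥ 1`, any tie rule).
[cite: RumpZimmermannBoldoMelquiond2009, §2.2 Theorem 2 (proof, first case)] -/
theorem theorem_2_low (hp : 1 ≤ p) (hfl : IsRoundNearest p emin fl) {c : ℚ} (hc : IsFloat p emin c)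
    (hlt : |c| < (2 : ℚ) ^ (emin + p - 1)) :
    IsPred p emin c (cinf fl p emin c) ∧ IsSucc p emin c (csup fl p emin c) := by
  have he := stepE_eq_eta hp hfl hc hlt
  have h8 := isPred_sub_eta_and_isSucc_add_eta_of_abs_lt hp hc
    (hlt.trans (two_zpow_lt_two_zpow_iff.mpr (by omega)))
  unfold cinf csup
  rw [he, fl_eq_self hfl h8.1.1, fl_eq_self hfl h8.2.1]
  exact h8

/-- (19), first step: for `|c| ≥ 2u⁻¹η = 2^(emin+p+1)`, `c' = fl(φ|c|) ≤ C := 2u·ufp(c)` — by (20)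
`φ|c| < (1 + u)C ≤ M⁺(C)` (both when `C` is normal and when `C` is subnormal).
[cite: RumpZimmermannBoldoMelquiond2009, §2.2 eqs. (19)–(20) and the two cases after (20)] -/
theorem fl_phi_le_two_u_ufp (hp : 1 ≤ p) (hfl : IsRoundNearest p emin fl) {c : ℚ}
    (hc : IsFloat p emin c) (hcU : (2 : ℚ) ^ (emin + p + 1) ≤ |c|) :
    fl (phi p * |c|) ≤ 2 * unitRoundoff p * ufp c := by
  have hc0 : c ≠ 0 := by
    rintro rfl; simp at hcU; linarith [two_zpow_pos' (emin + p + 1)]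
  obtain ⟨hufp, hEle, hElt⟩ := ufp_spec hc0
  have hEge : emin + p + 1 ≤ Int.log 2 |c| := le_log_of_two_zpow_le hcU
  have hcle := abs_le_sub_of_abs_lt_two_zpow hp hc hElt
  set E : ℤ := Int.log 2 |c| with hE
  set u := unitRoundoff p with hu
  set X : ℚ := (2 : ℚ) ^ E with hX
  have hupos : 0 < u := u_pos
  have hXpos : 0 < X := two_zpow_pos' _
  have hφ := phi_pos p
  have hC : 2 * u * X = (2 : ℚ) ^ (E - p + 1) := by rw [hu, hX, two_mul_u_mul_two_zpow]
  have hCF : IsFloat p emin ((2 : ℚ) ^ (E - p + 1)) := isFloat_two_zpow hp (by omega)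
  have h2X : (2 : ℚ) ^ (E + 1) = 2 * X := by rw [hX, two_zpow_shift (E + 1) E 1 (by ring), pow_one]
  have hC' : (2 : ℚ) ^ (E + 1 - (p : ℤ)) = 2 * u * X := by rw [hC]; exact two_zpow_congr (by ring)
  -- (20): `φ|c| < (1 + u)·C = 2uX + 2u²X`
  have hlt : phi p * |c| < 2 * u * X + 2 * u * u * X := by
    have h1 : phi p * |c| ≤ phi p * (2 * X - 2 * u * X) := by
      rw [← h2X, ← hC']; exact mul_le_mul_of_nonneg_left hcle hφ.le
    have h2 : phi p * (2 * X - 2 * u * X) = 2 * u * X + 2 * u * u * X - 4 * u * u * u * X := by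
      rw [phi, ← hu]; ring
    have h3 : 0 < u * u * u * X := by positivity
    linarith
  rw [hufp, hC]
  by_cases hCn : (2 : ℚ) ^ (emin + p - 1) ≤ (2 : ℚ) ^ (E - p + 1)
  · -- `C` normal: `succ(C) = C + 2uC`, `M⁺(C) = (1 + u)C`
    have hs := isSucc_add_two_u_ufp hp hCF (two_zpow_pos' _) hCn
    refine fl_le_of_lt_mid_succ hfl hCF hs ?_
    rw [ufp_two_zpow, ← hC, ← hu]
    have : (2 * u * X + (2 * u * X + 2 * u * (2 * u * X))) / 2 = 2 * u * X + 2 * u * u * X := by ring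
    linarith
  · -- `C` subnormal: `succ(C) = C + η`, and `uC ≤ η/4`
    push Not at hCn
    have hClt : |(2 : ℚ) ^ (E - p + 1)| < (2 : ℚ) ^ (emin + p) := by
      rw [abs_of_pos (two_zpow_pos' _)]
      exact hCn.trans (two_zpow_lt_two_zpow_iff.mpr (by omega))
    have h8 := (isPred_sub_eta_and_isSucc_add_eta_of_abs_lt hp hCF hClt).2
    refine fl_le_of_lt_mid_succ hfl hCF h8 ?_
    have hexp : E - p + 1 < emin + p - 1 := two_zpow_lt_two_zpow_iff.mp hCn
    have huC : 2 * u * u * X = (2 : ℚ) ^ (E - p + 1 - p) := by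
      rw [show 2 * u * u * X = u * (2 * u * X) by ring, hC, hu, u_mul_two_zpow]
    have h4 : (2 : ℚ) ^ (E - p + 1 - p) ≤ (2 : ℚ) ^ (emin - 2) := two_zpow_le_two_zpow (by omega)
    have hη : (2 : ℚ) ^ emin = 2 ^ 2 * (2 : ℚ) ^ (emin - 2) := two_zpow_shift emin (emin - 2) 2 (by ring)
    rw [← hC]
    have : ((2 * u * X) + (2 * u * X + (2 : ℚ) ^ emin)) / 2 = 2 * u * X + 2 * (2 : ℚ) ^ (emin - 2) := by
      rw [hη]; ring
    rw [this]
    rw [huC] at hlt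
    have := two_zpow_pos' (emin - 2)
    linarith

/-- **(19): `e ≤ ⁵⁄₂u·ufp(c)` for `|c| ≥ 2u⁻¹η`** (`p ≥ 3`; `⁵⁄₂u·ufp(c) = C + ½u·ufp(c) ∈ F` and
`c' + η ≤ C + ½u·ufp(c)`). [cite: RumpZimmermannBoldoMelquiond2009, §2.2 eq. (19) and its proof] -/
theorem stepE_le_five_halves_u_ufp (hp : 3 ≤ p) (hfl : IsRoundNearest p emin fl) {c : ℚ}
    (hc : IsFloat p emin c) (hcU : (2 : ℚ) ^ (emin + p + 1) ≤ |c|) :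
    stepE fl p emin c ≤ 5 / 2 * (unitRoundoff p * ufp c) := by
  have hp1 : 1 ≤ p := by omega
  have hc0 : c ≠ 0 := by
    rintro rfl; simp at hcU; linarith [two_zpow_pos' (emin + p + 1)]
  obtain ⟨hufp, hEle, hElt⟩ := ufp_spec hc0
  have hEge : emin + p + 1 ≤ Int.log 2 |c| := le_log_of_two_zpow_le hcU
  have hc' := fl_phi_le_two_u_ufp hp1 hfl hc hcU
  set E : ℤ := Int.log 2 |c| with hE
  -- `D := 2^(E-p-1) = ½u·ufp(c)`; `C = 4D`, `⁵⁄₂u·ufp(c) = 5D ∈ F`, `η ≤ D`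
  set D : ℚ := (2 : ℚ) ^ (E - p - 1) with hD
  have huX : unitRoundoff p * ufp c = 2 * D := by
    rw [hufp, u_mul_two_zpow, hD, two_zpow_shift (E - p) (E - p - 1) 1 (by ring), pow_one]
  have h5F : IsFloat p emin (5 / 2 * (unitRoundoff p * ufp c)) := by
    rw [huX, show (5 : ℚ) / 2 * (2 * D) = ((5 : ℤ) : ℚ) * (2 : ℚ) ^ (E - p - 1) by
      rw [hD]; push_cast; ring]
    refine isFloat_of_abs_le hp1 ?_ (by omega)
    have : (2 : ℤ) ^ 3 ≤ 2 ^ p := pow_le_pow_right₀ (by norm_num) hp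
    rw [abs_of_pos (by norm_num)]; omega
  have hηD : (2 : ℚ) ^ emin ≤ D := two_zpow_le_two_zpow (by omega)
  unfold stepE
  refine fl_le_of_le hfl h5F ?_
  rw [huX]
  linarith

/-- The `succ` side of Theorem 2 for `|c| ≥ 2u⁻¹η`, as the tie-free midpoint condition
`|c| + e < M⁺(succ|c|)` ("`c + e ≤ succ(c) + ½u·ufp(c) < M⁺(succ(c))`", from (9), (19), (10)).
[cite: RumpZimmermannBoldoMelquiond2009, §2.2 (proof of Theorem 2, the assertion for `csup`)] -/
theorem abs_add_stepE_lt_mid (hp : 3 ≤ p) (hfl : IsRoundNearest p emin fl) {c : ℚ}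
    (hc : IsFloat p emin c) (hcU : (2 : ℚ) ^ (emin + p + 1) ≤ |c|) {S SS : ℚ}
    (hS : IsSucc p emin |c| S) (hSS : IsSucc p emin S SS) :
    |c| + stepE fl p emin c < (S + SS) / 2 := by
  have hp1 : 1 ≤ p := by omega
  have hc0 : c ≠ 0 := by
    rintro rfl; simp at hcU; linarith [two_zpow_pos' (emin + p + 1)]
  have ha0 : 0 < |c| := abs_pos.mpr hc0
  have haF : IsFloat p emin |c| := isFloat_abs hc
  have haU : (2 : ℚ) ^ (emin + p - 1) ≤ |c| := (two_zpow_le_two_zpow (by omega)).trans hcU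
  have h19 := stepE_le_five_halves_u_ufp hp hfl hc hcU
  have hupos : 0 < unitRoundoff p := u_pos
  have hufp0 : 0 < ufp c := ufp_pos hc0
  -- `S = |c| + 2u·ufp(c)`, `SS = S + 2u·ufp(S)`, `ufp(S) ≥ ufp(c)`
  have hS' := isSucc_add_two_u_ufp hp1 haF ha0 haU
  rw [ufp_abs] at hS'
  have hSeq : S = |c| + 2 * unitRoundoff p * ufp c := hS.unique hS'
  have huc : 0 < unitRoundoff p * ufp c := mul_pos hupos hufp0
  have hS0 : 0 < S := by rw [hSeq]; linarith
  have hSU : (2 : ℚ) ^ (emin + p - 1) ≤ S := by rw [hSeq]; linarith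
  have hSS' := isSucc_add_two_u_ufp hp1 hS.1 hS0 hSU
  have hSSeq : SS = S + 2 * unitRoundoff p * ufp S := hSS.unique hSS'
  have hmono : ufp c ≤ ufp S := by
    rw [← ufp_abs c]; exact ufp_mono (by rw [abs_abs, abs_of_pos hS0, hSeq]; linarith)
  have h1 : unitRoundoff p * ufp c ≤ unitRoundoff p * ufp S := mul_le_mul_of_nonneg_left hmono hupos.le
  linarith [hSeq, hSSeq]

/-- `e` at a float of the form `|c| = (1 + 2u)·2^E`, `E ≥ emin + p + 1` (the case `pred(c) = ufp(c)` of
the printed proof): `e ≤ 2u·ufp(c) = C` (`p ≥ 4`), so that `c − e ≥ pred(c)`.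
[cite: RumpZimmermannBoldoMelquiond2009, §2.2 (proof of Theorem 2, "If `pred(c) = ufp(c)`, i.e.,
`c = ufp(c)(1 + 2u)`")] -/
theorem stepE_le_two_u_ufp_of_eq (hp : 4 ≤ p) (hfl : IsRoundNearest p emin fl) {c : ℚ} {E : ℤ}
    (hE : emin + p + 1 ≤ E) (hcE : |c| = (2 : ℚ) ^ E + (2 : ℚ) ^ (E - p + 1)) :
    stepE fl p emin c ≤ (2 : ℚ) ^ (E - p + 1) := by
  have hp1 : 1 ≤ p := by omega
  set u := unitRoundoff p with hu
  have hupos : 0 < u := u_pos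
  have hu16 : u ≤ 1 / 16 := by have := u_le_of_le (p := p) hp; norm_num at this; rw [hu]; exact this
  -- `D := 2^(E-p-1)`: `u·2^E = 2D`, `C = 2^(E-p+1) = 4D`, `3D ∈ F`, `η ≤ D`
  set D : ℚ := (2 : ℚ) ^ (E - p - 1) with hD
  have hDpos : 0 < D := two_zpow_pos' _
  have huE : u * (2 : ℚ) ^ E = 2 * D := by
    rw [hu, u_mul_two_zpow, hD, two_zpow_shift (E - p) (E - p - 1) 1 (by ring), pow_one]
  have hC : (2 : ℚ) ^ (E - p + 1) = 4 * D := by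
    rw [hD, two_zpow_shift (E - p + 1) (E - p - 1) 2 (by ring)]; norm_num
  have h3F : IsFloat p emin (3 * D) := by
    rw [hD, show (3 : ℚ) = ((3 : ℤ) : ℚ) by norm_num]
    refine isFloat_of_abs_le hp1 ?_ (by omega)
    have : (2 : ℤ) ^ 2 ≤ 2 ^ p := pow_le_pow_right₀ (by norm_num) (by omega)
    rw [abs_of_pos (by norm_num)]; omega
  have hCF : IsFloat p emin ((2 : ℚ) ^ (E - p + 1)) := isFloat_two_zpow hp1 (by omega)
  have hηD : (2 : ℚ) ^ emin ≤ D := two_zpow_le_two_zpow (by omega)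
  -- `φ|c| = u(1 + 2u)²·2^E = 2D(1 + 4u + 4u²) ≤ 3D`
  have hφc : phi p * |c| ≤ 3 * D := by
    have h1 : phi p * |c| = 2 * D + 2 * D * (4 * u + 4 * u * u) := by
      rw [hcE, hC, phi, ← hu]; linear_combination (1 + 2 * u) * huE
    have key : 4 * u + 4 * u * u ≤ 1 / 2 := by nlinarith
    have h2 := mul_le_mul_of_nonneg_left key (show (0 : ℚ) ≤ 2 * D by positivity)
    rw [h1]; linarith
  have hc' : fl (phi p * |c|) ≤ 3 * D := fl_le_of_le hfl h3F hφc
  unfold stepE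
  refine fl_le_of_le hfl hCF ?_
  rw [hC]
  linarith

/-- `e` at a power of two `|c| = 2^E`, `E ≥ emin + p + 2` (the case `c = ufp(c)` of the printed proof):
`e ≤ ⁵⁄₄u·|c| < ³⁄₂u·|c|`, so that `c − e > M⁻(pred(c))`. For `p ≥ 5` this holds for any tie rule; for
`p = 4` the single input `|c| = ¼u⁻²η = 2^(emin+6)` produces the tie `φ|c| = 2^(emin+2) + ½η`, and the
bound needs that tie to go DOWN (to the even significand `4`), hypothesis `htie`.
[cite: RumpZimmermannBoldoMelquiond2009, §2.2 (proof of Theorem 2, the three cases `c ≥ ½u⁻²η`,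
`c < ¼u⁻²η`, `c = ¼u⁻²η` incl. "the tie is rounded to even"; Remark 2)] -/
theorem stepE_le_of_abs_eq_two_zpow (hp : 4 ≤ p) (hfl : IsRoundNearest p emin fl) {c : ℚ} {E : ℤ}
    (htie : p = 4 → E = emin + 6 → fl ((2 : ℚ) ^ (emin + 2) + (2 : ℚ) ^ (emin - 1)) = (2 : ℚ) ^ (emin + 2))
    (hE : emin + p + 2 ≤ E) (hcE : |c| = (2 : ℚ) ^ E) :
    stepE fl p emin c ≤ 5 / 4 * (unitRoundoff p * (2 : ℚ) ^ E) := by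
  have hp1 : 1 ≤ p := by omega
  set u := unitRoundoff p with hu
  have hupos : 0 < u := u_pos
  have huEpos : 0 < u * (2 : ℚ) ^ E := mul_pos hupos (two_zpow_pos' E)
  -- `D := 2^(E-p-2)`: `u·2^E = 4D`, `⁵⁄₄u2^E = 5D ∈ F`, `η ≤ D`
  set D : ℚ := (2 : ℚ) ^ (E - p - 2) with hD
  have hDpos : 0 < D := two_zpow_pos' _
  have huE' : u * (2 : ℚ) ^ E = (2 : ℚ) ^ (E - p) := by rw [hu, u_mul_two_zpow]
  have huE : u * (2 : ℚ) ^ E = 4 * D := by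
    rw [huE', hD, two_zpow_shift (E - p) (E - p - 2) 2 (by ring)]; norm_num
  have huEF : IsFloat p emin (u * (2 : ℚ) ^ E) := by rw [huE']; exact isFloat_two_zpow hp1 (by omega)
  have h5F : IsFloat p emin (5 / 4 * (u * (2 : ℚ) ^ E)) := by
    rw [huE, show (5 : ℚ) / 4 * (4 * D) = ((5 : ℤ) : ℚ) * (2 : ℚ) ^ (E - p - 2) by
      rw [hD]; push_cast; ring]
    refine isFloat_of_abs_le hp1 ?_ (by omega)
    have : (2 : ℤ) ^ 3 ≤ 2 ^ p := pow_le_pow_right₀ (by norm_num) (by omega)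
    rw [abs_of_pos (by norm_num)]; omega
  have hηD : (2 : ℚ) ^ emin ≤ D := two_zpow_le_two_zpow (by omega)
  -- `φ|c| = u2^E + 2u²2^E = 4D + 2^(E+1-2p)`
  have hT : 2 * u * u * (2 : ℚ) ^ E = (2 : ℚ) ^ (E + 1 - 2 * p) := by
    rw [show 2 * u * u * (2 : ℚ) ^ E = 2 * u * (u * (2 : ℚ) ^ E) by ring, huE', hu,
      two_mul_u_mul_two_zpow]
    exact two_zpow_congr (by ring)
  have hφc : phi p * |c| = 4 * D + (2 : ℚ) ^ (E + 1 - 2 * p) := by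
    rw [hcE, phi, ← hu, ← hT, ← huE]; ring
  have h4Dlt : |u * (2 : ℚ) ^ E| < (2 : ℚ) ^ (emin + p) ∨ emin - 1 < E + 1 - 2 * p := by
    rcases le_or_gt (E + 1 - 2 * p) (emin - 1) with h | h
    · left
      rw [abs_of_pos huEpos, huE']
      exact two_zpow_lt_two_zpow_iff.mpr (by omega)
    · right; exact h
  unfold stepE
  refine fl_le_of_le hfl h5F ?_
  rw [huE]
  -- it remains: `c' + η ≤ 5D`; three cases on the position of `2u²·2^E = 2^(E+1-2p)` relative to `η`
  rcases lt_trichotomy (E + 1 - 2 * p) (emin - 1) with hlt | heq | hgt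
  · -- `2u²2^E ≤ η/4`: `c' ≤ u2^E = 4D` by the midpoint of `4D` (spacing `η` there), `η ≤ D`
    have h8 := (isPred_sub_eta_and_isSucc_add_eta_of_abs_lt hp1 huEF
      (h4Dlt.resolve_right (by omega))).2
    have hc' : fl (phi p * |c|) ≤ u * (2 : ℚ) ^ E := by
      refine fl_le_of_lt_mid_succ hfl huEF h8 ?_
      rw [hφc, huE]
      have h1 : (2 : ℚ) ^ (E + 1 - 2 * p) ≤ (2 : ℚ) ^ (emin - 2) := two_zpow_le_two_zpow (by omega)
      have h2 : (2 : ℚ) ^ emin = 2 ^ 2 * (2 : ℚ) ^ (emin - 2) := two_zpow_shift emin (emin - 2) 2 (by ring)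
      rw [h2]; norm_num; linarith [two_zpow_pos' (emin - 2)]
    rw [huE] at hc'
    linarith
  · -- THE TIE `E = emin + 2p − 2`: `φ|c| = 4D + η/2` with `4D = 2^(emin+p-2)`
    rcases (show p = 4 ∨ 5 ≤ p by omega) with hp4 | hp5
    · -- `p = 4`: the tie goes down (hypothesis), `c' = 4D`, `c' + η = 5D`
      have h4D : 4 * D = (2 : ℚ) ^ (emin + 2) := by rw [← huE, huE']; exact two_zpow_congr (by omega)
      have hη' : (2 : ℚ) ^ (E + 1 - 2 * p) = (2 : ℚ) ^ (emin - 1) := two_zpow_congr (by omega)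
      have hc' : fl (phi p * |c|) = 4 * D := by rw [hφc, h4D, hη', htie hp4 (by omega)]
      have hηeq : (2 : ℚ) ^ emin = D := by rw [hD]; exact two_zpow_congr (by omega)
      rw [hc', hηeq]; linarith
    · -- `p ≥ 5`: `c' ≤ 4D + η` (a float above the tie) and `2η ≤ D`
      have hGF : IsFloat p emin (u * (2 : ℚ) ^ E + (2 : ℚ) ^ emin) :=
        (isPred_sub_eta_and_isSucc_add_eta_of_abs_lt hp1 huEF (h4Dlt.resolve_right (by omega))).2.1
      have hc' : fl (phi p * |c|) ≤ u * (2 : ℚ) ^ E + (2 : ℚ) ^ emin := by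
        refine fl_le_of_le hfl hGF ?_
        rw [hφc, huE, heq]
        have : (2 : ℚ) ^ emin = 2 ^ 1 * (2 : ℚ) ^ (emin - 1) := two_zpow_shift emin (emin - 1) 1 (by ring)
        rw [this, pow_one]; linarith [two_zpow_pos' (emin - 1)]
      have h2η : 2 * (2 : ℚ) ^ emin ≤ D := by
        rw [hD, show 2 * (2 : ℚ) ^ emin = (2 : ℚ) ^ (emin + 1) by
          rw [two_zpow_shift (emin + 1) emin 1 (by ring), pow_one]]
        exact two_zpow_le_two_zpow (by omega)
      rw [huE] at hc'
      linarith
  · -- `2u²2^E ≥ η`: `φ|c| ∈ F`, `c' = φ|c|`, and `2^(E+1-2p) ≤ D/2`, `η ≤ D/2`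
    have hφF : IsFloat p emin (phi p * |c|) := by
      have h2 : (2 : ℚ) ^ (E - p) = (2 : ℚ) ^ (p - 1 : ℕ) * (2 : ℚ) ^ (E + 1 - 2 * p) := by
        rw [← zpow_natCast, Nat.cast_sub hp1, ← zpow_add₀ (by norm_num : (2 : ℚ) ≠ 0)]
        exact two_zpow_congr (by push_cast; ring)
      have hrepr : phi p * |c| = (((2 : ℤ) ^ (p - 1) + 1 : ℤ) : ℚ) * (2 : ℚ) ^ (E + 1 - 2 * p) := by
        rw [hφc, ← huE, huE', h2]; push_cast; ring
      rw [hrepr]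
      refine isFloat_of_abs_le hp1 ?_ (by omega)
      have h1 : (0 : ℤ) < 2 ^ (p - 1) := by positivity
      have hp' : (2 : ℤ) ^ p = 2 ^ (p - 1) * 2 := by rw [← pow_succ]; congr 1; omega
      rw [abs_of_pos (by omega)]; omega
    have hc' : fl (phi p * |c|) = phi p * |c| := fl_eq_self hfl hφF
    have h1 : (2 : ℚ) ^ (E + 1 - 2 * p) ≤ (2 : ℚ) ^ (E - p - 3) := two_zpow_le_two_zpow (by omega)
    have h2 : (2 : ℚ) ^ emin ≤ (2 : ℚ) ^ (E - p - 3) := two_zpow_le_two_zpow (by omega)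
    have h3 : D = 2 ^ 1 * (2 : ℚ) ^ (E - p - 3) := by rw [hD]; exact two_zpow_shift _ _ 1 (by ring)
    rw [hc', hφc, h3, pow_one]
    linarith

/-- The `pred` side of Theorem 2 for `|c| > 2u⁻¹η`, as the tie-free midpoint condition
`M⁻(pred|c|) < |c| − e` (the three cases `pred(pred(c)) ≥ ufp(c)`, `ufp(c) = pred(c)`, `ufp(c) = c`
of the printed proof). [cite: RumpZimmermannBoldoMelquiond2009, §2.2 (proof of Theorem 2, the
assertion for `cinf`)] -/
theorem mid_lt_abs_sub_stepE (hp : 4 ≤ p) (hfl : IsRoundNearest p emin fl) {c : ℚ}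
    (htie : p = 4 → |c| = (2 : ℚ) ^ (emin + 6) →
      fl ((2 : ℚ) ^ (emin + 2) + (2 : ℚ) ^ (emin - 1)) = (2 : ℚ) ^ (emin + 2))
    (hc : IsFloat p emin c) (hcU : (2 : ℚ) ^ (emin + p + 1) < |c|) {P PP : ℚ}
    (hP : IsPred p emin |c| P) (hPP : IsPred p emin P PP) :
    (PP + P) / 2 < |c| - stepE fl p emin c := by
  have hp1 : 1 ≤ p := by omega
  have hc0 : c ≠ 0 := by
    rintro rfl; simp at hcU; linarith [two_zpow_pos' (emin + p + 1)]
  have ha0 : 0 < |c| := abs_pos.mpr hc0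
  have haF : IsFloat p emin |c| := isFloat_abs hc
  obtain ⟨hufp, hEle, hElt⟩ := ufp_spec hc0
  have hEge : emin + p + 1 ≤ Int.log 2 |c| := le_log_of_two_zpow_le hcU.le
  have h19 := stepE_le_five_halves_u_ufp (by omega : 3 ≤ p) hfl hc hcU.le
  have haU : (2 : ℚ) ^ (emin + p - 1) ≤ |c| := (two_zpow_le_two_zpow (by omega)).trans hcU.le
  set E : ℤ := Int.log 2 |c| with hE
  set u := unitRoundoff p with hu
  set X : ℚ := (2 : ℚ) ^ E with hX
  have hupos : 0 < u := u_pos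
  have hXpos : 0 < X := two_zpow_pos' _
  have hXF : IsFloat p emin X := isFloat_two_zpow hp1 (by omega)
  have hufpa : ufp |c| = X := by rw [ufp_abs, hufp]
  have hC : 2 * u * X = (2 : ℚ) ^ (E - p + 1) := by rw [hu, hX, two_mul_u_mul_two_zpow]
  have hu16 : u ≤ 1 / 16 := by have := u_le_of_le (p := p) hp; norm_num at this; rw [hu]; exact this
  rcases eq_or_ne |c| X with haX | haX
  · -- `|c| = ufp(c) = 2^E`, `E ≥ emin + p + 2`: `P = X − uX`, `PP = X − 2uX`, `e ≤ ⁵⁄₄uX`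
    have hEge' : emin + p + 2 ≤ E := by
      have hXlt : (2 : ℚ) ^ (emin + p + 1) < (2 : ℚ) ^ E := by rw [← hX]; exact hcU.trans_le haX.le
      have := two_zpow_lt_two_zpow_iff.mp hXlt; omega
    have he := stepE_le_of_abs_eq_two_zpow hp hfl
      (fun h4 h6 => htie h4 (by rw [haX, hX]; exact two_zpow_congr h6)) hEge' haX
    rw [← hX, ← hu] at he
    have hP' := isPred_two_zpow (p := p) (emin := emin) hp1 (E := E) (by omega)
    rw [← hX] at hP'
    have huX : (2 : ℚ) ^ (E - p) = u * X := by rw [hu, hX, u_mul_two_zpow]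
    rw [huX] at hP'
    rw [haX] at hP ⊢
    have hPeq : P = X - u * X := hP.unique hP'
    -- `PP = P − 2u·ufp(P)` with `ufp(P) = X/2`
    have hP0 : 0 < P := by rw [hPeq]; nlinarith
    have hX2 : X / 2 = (2 : ℚ) ^ (E - 1) := by
      rw [hX, two_zpow_shift E (E - 1) 1 (by ring), pow_one]; ring
    have hPU : (2 : ℚ) ^ (emin + p - 1) ≤ P := by
      have : (2 : ℚ) ^ (emin + p - 1) ≤ (2 : ℚ) ^ (E - 1) := two_zpow_le_two_zpow (by omega)
      rw [← hX2] at this; rw [hPeq]; nlinarith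
    have hufpP : ufp P = X / 2 := by
      rw [hX2]
      refine ufp_eq_two_zpow_of_le_of_lt ?_ ?_
      · rw [abs_of_pos hP0, ← hX2, hPeq]; nlinarith
      · rw [abs_of_pos hP0, hPeq]
        have : (2 : ℚ) ^ (E - 1 + 1) = X := by rw [hX]; exact two_zpow_congr (by ring)
        rw [this]; nlinarith
    have hPP' := isPred_sub_two_u_ufp hp1 hP.1 hP0 hPU (by rw [hufpP, hPeq]; apply ne_of_lt; nlinarith)
    have hPPeq : PP = P - 2 * u * (X / 2) := by rw [hPP.unique hPP', hufpP]
    rw [hPPeq, hPeq]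
    nlinarith
  · -- `|c|` is not a power of two: `P = |c| − 2uX`
    have hP' := isPred_sub_two_u_ufp hp1 haF ha0 haU (by rw [hufpa]; exact fun h => haX h.symm)
    rw [hufpa] at hP'
    have hPeq : P = |c| - 2 * u * X := by rw [hP.unique hP']
    have hXleP : X ≤ P := hP.2.2 X hXF (lt_of_le_of_ne hEle (Ne.symm haX))
    rcases eq_or_ne P X with hPX | hPX
    · -- `pred(c) = ufp(c)`: `|c| = X + 2uX`, `e ≤ 2uX`, so `|c| − e ≥ P > M⁻(P)`
      have hcE : |c| = (2 : ℚ) ^ E + (2 : ℚ) ^ (E - p + 1) := by rw [← hC, ← hX]; linarith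
      have he := stepE_le_two_u_ufp_of_eq hp hfl hEge hcE
      rw [← hC] at he
      have hPPlt : PP < P := hPP.2.1
      rw [hPX] at hPPlt ⊢
      linarith
    · -- `pred(pred(c)) ≥ ufp(c)`: `PP = P − 2uX`, `M⁻(P) = |c| − 3uX < |c| − ⁵⁄₂uX ≤ |c| − e`
      have hXltP : X < P := lt_of_le_of_ne hXleP (Ne.symm hPX)
      have hP0 : 0 < P := hXpos.trans hXltP
      have hPU : (2 : ℚ) ^ (emin + p - 1) ≤ P :=
        le_of_lt (lt_of_le_of_lt ((two_zpow_le_two_zpow (by omega)).trans (le_of_eq hX.symm)) hXltP)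
      have hufpP : ufp P = X := by
        rw [hX]
        refine ufp_eq_two_zpow_of_le_of_lt ?_ ?_
        · rw [abs_of_pos hP0, ← hX]; exact hXltP.le
        · rw [abs_of_pos hP0]; exact lt_trans hP.2.1 hElt
      have hPP' := isPred_sub_two_u_ufp hp1 hP.1 hP0 hPU (by rw [hufpP]; exact hPX.symm)
      have hPPeq : PP = P - 2 * u * X := by rw [hPP.unique hPP', hufpP]
      rw [hPPeq, hPeq]
      rw [hufp] at h19
      nlinarith

/-- **THEOREM 2, the range `|c| > 2u⁻¹η`** (`u ≤ ¹⁄₁₆`, i.e. `p ≥ 4`): `fl(c − e) = pred(c)` and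
`fl(c + e) = succ(c)`. Tie rule: arbitrary for `p ≥ 5` (REMARK 2); for `p = 4` the one tie that occurs
inside the algorithm (`φ|c|` at `|c| = ¼u⁻²η`) must be resolved downwards = to even (`htie`), as IEEE 754
round-to-nearest-even does (`theorem_2_tiesEven`); ties-to-away resolves it upwards and is handled
separately (`theorem_2_tiesAway`). [cite: RumpZimmermannBoldoMelquiond2009, §2.2 Theorem 2 and Remark 2] -/
theorem theorem_2_high (hp : 4 ≤ p) (hfl : IsRoundNearest p emin fl) {c : ℚ}
    (htie : p = 4 → |c| = (2 : ℚ) ^ (emin + 6) →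
      fl ((2 : ℚ) ^ (emin + 2) + (2 : ℚ) ^ (emin - 1)) = (2 : ℚ) ^ (emin + 2))
    (hc : IsFloat p emin c) (hcU : (2 : ℚ) ^ (emin + p + 1) < |c|) :
    IsPred p emin c (cinf fl p emin c) ∧ IsSucc p emin c (csup fl p emin c) := by
  have hp1 : 1 ≤ p := by omega
  have hc0 : c ≠ 0 := by
    rintro rfl; simp at hcU; linarith [two_zpow_pos' (emin + p + 1)]
  have haF : IsFloat p emin |c| := isFloat_abs hc
  obtain ⟨P, hP⟩ := exists_isPred hp1 haF
  obtain ⟨PP, hPP⟩ := exists_isPred hp1 hP.1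
  obtain ⟨S, hS⟩ := exists_isSucc hp1 haF
  obtain ⟨SS, hSS⟩ := exists_isSucc hp1 hS.1
  have hPside := mid_lt_abs_sub_stepE hp hfl htie hc hcU hP hPP
  have hSside := abs_add_stepE_lt_mid (by omega) hfl hc hcU.le hS hSS
  rcases lt_or_gt_of_ne hc0 with hneg | hpos
  · -- `c < 0`: `pred(c) = −S`, `succ(c) = −P`
    rw [abs_of_neg hneg] at hP hS hPside hSside
    have hpredc : IsPred p emin c (-S) := by rw [← neg_neg c]; exact isPred_neg_iff.mpr hS
    have hsuccc : IsSucc p emin c (-P) := by rw [← neg_neg c]; exact isSucc_neg_iff.mpr hP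
    obtain ⟨h1lo, h1hi⟩ := theorem_1 (by omega) hfl hc hpredc hsuccc
    have hlo : -S ≤ cinf fl p emin c :=
      le_fl_of_mid_pred_lt hfl hS.1.neg (isPred_neg_iff.mpr hSS) (by linarith)
    have hhi : csup fl p emin c ≤ -P :=
      fl_le_of_lt_mid_succ hfl hP.1.neg (isSucc_neg_iff.mpr hPP) (by linarith)
    rw [le_antisymm h1lo hlo, le_antisymm hhi h1hi]
    exact ⟨hpredc, hsuccc⟩
  · rw [abs_of_pos hpos] at hP hS hPside hSside
    obtain ⟨h1lo, h1hi⟩ := theorem_1 (by omega) hfl hc hP hS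
    have hlo : P ≤ cinf fl p emin c := le_fl_of_mid_pred_lt hfl hP.1 hPP (by linarith)
    have hhi : csup fl p emin c ≤ S := fl_le_of_lt_mid_succ hfl hS.1 hSS (by linarith)
    rw [le_antisymm h1lo hlo, le_antisymm hhi h1hi]
    exact ⟨hP, hS⟩

/-- **THEOREM 2.** For `c ∈ F` with `|c| ∉ [½u⁻¹η, 2u⁻¹η] = [2^(emin+p-1), 2^(emin+p+1)]` and
`u ≤ ¹⁄₁₆` (`p ≥ 4`), Algorithm 1 returns `cinf = pred(c)` and `csup = succ(c)` — here for every
rounding to nearest whose tie rule sends `2^(emin+2) + ½η` to `2^(emin+2)` when `p = 4` (true for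
ties-to-even, `theorem_2_tiesEven`; vacuous for `p ≥ 5`, REMARK 2, `theorem_2_of_five_le`); the second
tie rule named in the printed statement, ties-to-away, is `theorem_2_tiesAway`.
[cite: RumpZimmermannBoldoMelquiond2009, §2.2 Theorem 2, Remark 2] -/
theorem theorem_2 (hp : 4 ≤ p) (hfl : IsRoundNearest p emin fl)
    (htie : p = 4 → fl ((2 : ℚ) ^ (emin + 2) + (2 : ℚ) ^ (emin - 1)) = (2 : ℚ) ^ (emin + 2))
    {c : ℚ} (hc : IsFloat p emin c)
    (hrange : |c| < (2 : ℚ) ^ (emin + p - 1) ∨ (2 : ℚ) ^ (emin + p + 1) < |c|) :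
    IsPred p emin c (cinf fl p emin c) ∧ IsSucc p emin c (csup fl p emin c) := by
  rcases hrange with hlt | hgt
  · exact theorem_2_low (by omega) hfl hc hlt
  · exact theorem_2_high hp hfl (fun h _ => htie h) hc hgt

/-- **REMARK 2**: for `u ≤ ¹⁄₃₂` (`p ≥ 5`) Theorem 2 holds for ANY tie-breaking rule in rounding to
nearest. [cite: RumpZimmermannBoldoMelquiond2009, §2.2 Remark 2] -/
theorem theorem_2_of_five_le (hp : 5 ≤ p) (hfl : IsRoundNearest p emin fl) {c : ℚ}
    (hc : IsFloat p emin c)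
    (hrange : |c| < (2 : ℚ) ^ (emin + p - 1) ∨ (2 : ℚ) ^ (emin + p + 1) < |c|) :
    IsPred p emin c (cinf fl p emin c) ∧ IsSucc p emin c (csup fl p emin c) :=
  theorem_2 (by omega) hfl (fun h => by omega) hc hrange

/-- Theorem 2's upper range from `½u⁻²η = 2^(emin+2p-1)` on needs NO tie hypothesis (the only
tie-sensitive input `|c| = ¼u⁻²η` lies below): this is the form used by Theorem 3.
[cite: RumpZimmermannBoldoMelquiond2009, §2.2 Theorem 2; §2.2 (proof of Theorem 3, "if"-clause)] -/
theorem theorem_2_high_of_le (hp : 4 ≤ p) (hfl : IsRoundNearest p emin fl) {c : ℚ}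
    (hc : IsFloat p emin c) (hcU : (2 : ℚ) ^ (emin + 2 * p - 1) ≤ |c|) :
    IsPred p emin c (cinf fl p emin c) ∧ IsSucc p emin c (csup fl p emin c) := by
  refine theorem_2_high hp hfl (fun h4 h6 => ?_) hc
    (lt_of_lt_of_le (two_zpow_lt_two_zpow_iff.mpr (by omega)) hcU)
  exfalso
  rw [h6] at hcU
  have := (zpow_le_zpow_iff_right₀ (by norm_num : (1 : ℚ) < 2)).mp hcU
  omega

/-- The one tie Theorem 2 meets at `p = 4` is resolved downwards by ties-to-even:
`RN_e(2^(emin+2) + ½η) = 2^(emin+2)` (scaled significand `⌊4.5⌋ = 4` is even).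
[cite: RumpZimmermannBoldoMelquiond2009, §2.2 (proof of Theorem 2, third case: "If the computation of
`fl(φc)` is rounded to nearest with ties to even, then `c' = fl(φc) = uc`")] -/
theorem roundTiesEven_tie_prec_four (emin : ℤ) :
    roundTiesEven 4 emin ((2 : ℚ) ^ (emin + 2) + (2 : ℚ) ^ (emin - 1)) = (2 : ℚ) ^ (emin + 2) := by
  set η : ℚ := (2 : ℚ) ^ emin with hη
  have hηpos : 0 < η := two_zpow_pos' _
  have h4 : (2 : ℚ) ^ (emin + 2) = 4 * η := by
    rw [hη, two_zpow_shift (emin + 2) emin 2 (by ring)]; norm_num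
  have hh : (2 : ℚ) ^ (emin - 1) = η / 2 := by
    have : η = 2 ^ 1 * (2 : ℚ) ^ (emin - 1) := two_zpow_shift emin (emin - 1) 1 (by ring)
    rw [pow_one] at this; linarith
  have ht : (2 : ℚ) ^ (emin + 2) + (2 : ℚ) ^ (emin - 1) = 9 / 2 * η := by rw [h4, hh]; ring
  have hulp : ulp 4 emin (9 / 2 * η) = η := by
    apply ulp_eq_of_abs_lt
    rw [abs_of_pos (by positivity),
      show (2 : ℚ) ^ (emin + ((4 : ℕ) : ℤ) - 1) = 2 ^ 3 * η from two_zpow_shift _ emin 3 (by push_cast; ring)]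
    linarith
  have hfloor : ⌊9 / 2 * η / η⌋ = (4 : ℤ) := by
    rw [mul_div_assoc, div_self hηpos.ne', mul_one, Int.floor_eq_iff]; norm_num
  rw [ht]
  have htie : 9 / 2 * η - (⌊9 / 2 * η / ulp 4 emin (9 / 2 * η)⌋ : ℚ) * ulp 4 emin (9 / 2 * η) =
      ((⌊9 / 2 * η / ulp 4 emin (9 / 2 * η)⌋ : ℚ) + 1) * ulp 4 emin (9 / 2 * η) - 9 / 2 * η := by
    rw [hulp, hfloor]; push_cast; ring
  rw [roundTiesEven_of_tie htie, hulp, hfloor, if_pos (by decide), h4]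
  push_cast
  ring

/-- **THEOREM 2 for IEEE 754 round-to-nearest-even** (`RN_e = roundTiesEven`), `u ≤ ¹⁄₁₆`: the tie
hypothesis of `theorem_2` is discharged. [cite: RumpZimmermannBoldoMelquiond2009, §2.2 Theorem 2
("Assume the rounding is 'ties to even' […] as defined by IEEE 754-2008")] -/
theorem theorem_2_tiesEven (hp : 4 ≤ p) {c : ℚ} (hc : IsFloat p emin c)
    (hrange : |c| < (2 : ℚ) ^ (emin + p - 1) ∨ (2 : ℚ) ^ (emin + p + 1) < |c|) :
    IsPred p emin c (cinf (roundTiesEven p emin) p emin c) ∧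
      IsSucc p emin c (csup (roundTiesEven p emin) p emin c) :=
  theorem_2 hp (isRoundNearest_roundTiesEven (by omega))
    (fun h4 => by subst h4; exact roundTiesEven_tie_prec_four emin) hc hrange

/-! ### Theorem 2 under "ties to away" (IEEE 754-2008 `roundTiesToAway`) -/

/-- The tie-breaking attribute "ties to away (from zero)" of a rounding `fl`: whenever a float `f` is as
near to `t` as `fl(t)` is, `|f| ≤ |fl(t)|`.
[cite: RumpZimmermannBoldoMelquiond2009, §2.2 Theorem 2 ("or 'ties to away' as defined by IEEE 754-2008")] -/
def IsTiesAway (p : ℕ) (emin : ℤ) (fl : ℚ → ℚ) : Prop :=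
  ∀ t f : ℚ, IsFloat p emin f → |t - f| = |t - fl t| → |f| ≤ |fl t|

/-- At the midpoint of two consecutive floats `f < g` a rounding to nearest returns `f` or `g`.
[cite: RumpZimmermannBoldoMelquiond2009, §2 eqs. (11)–(12) (the midpoints `M⁻(c)`, `M⁺(c)`: only AT a midpoint is the tie rule consulted)] -/
theorem fl_midpoint_eq_or (hfl : IsRoundNearest p emin fl) {f g : ℚ} (hf : IsFloat p emin f)
    (hfg : IsSucc p emin f g) : fl ((f + g) / 2) = f ∨ fl ((f + g) / 2) = g := by
  have hF := (hfl ((f + g) / 2)).1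
  have h1 := (hfl ((f + g) / 2)).2 f hf
  have hlt : f < g := hfg.2.1
  rw [show |(f + g) / 2 - f| = (g - f) / 2 by rw [abs_of_nonneg (by linarith)]; ring] at h1
  rcases lt_trichotomy (fl ((f + g) / 2)) f with hlo | heq | hgt
  · exfalso; rw [abs_of_nonneg (by linarith)] at h1; linarith
  · exact Or.inl heq
  · rcases lt_trichotomy (fl ((f + g) / 2)) g with hlo' | heq' | hgt'
    · exfalso; have := hfg.2.2 _ hF hgt; linarith
    · exact Or.inr heq'
    · exfalso; rw [abs_of_nonpos (by linarith)] at h1; linarith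

/-- Ties-to-away at a midpoint of consecutive floats `0 ≤ f < g`: the result is `g`.
[cite: RumpZimmermannBoldoMelquiond2009, §2.2 Theorem 2 ("'ties to away' as defined by IEEE 754-2008"); proof of Theorem 2, third case ("`c' = fl(φc) = fl(uc + ½η) = uc + η`")] -/
theorem fl_midpoint_of_tiesAway_nonneg (hfl : IsRoundNearest p emin fl) (haway : IsTiesAway p emin fl)
    {f g : ℚ} (hf : IsFloat p emin f) (hfg : IsSucc p emin f g) (hf0 : 0 ≤ f) : fl ((f + g) / 2) = g := by
  have hlt := hfg.2.1
  rcases fl_midpoint_eq_or hfl hf hfg with h | h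
  · exfalso
    have := haway ((f + g) / 2) g hfg.1
      (by rw [h, abs_of_nonpos (by linarith), abs_of_nonneg (by linarith)]; ring)
    rw [h, abs_of_nonneg (by linarith), abs_of_nonneg hf0] at this
    linarith
  · exact h

/-- Ties-to-away at a midpoint of consecutive floats `f < g ≤ 0`: the result is `f`.
[cite: RumpZimmermannBoldoMelquiond2009, §2.2 Theorem 2 ("'ties to away' as defined by IEEE 754-2008"), by the symmetry `F = −F`] -/
theorem fl_midpoint_of_tiesAway_nonpos (hfl : IsRoundNearest p emin fl) (haway : IsTiesAway p emin fl)
    {f g : ℚ} (hf : IsFloat p emin f) (hfg : IsSucc p emin f g) (hg0 : g ≤ 0) : fl ((f + g) / 2) = f := by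
  have hlt := hfg.2.1
  rcases fl_midpoint_eq_or hfl hf hfg with h | h
  · exact h
  · exfalso
    have := haway ((f + g) / 2) f hf
      (by rw [h, abs_of_nonneg (by linarith), abs_of_nonpos (by linarith)]; ring)
    rw [h, abs_of_nonpos (by linarith : f ≤ 0), abs_of_nonpos hg0] at this
    linarith

/-- **THEOREM 2 at its one tie-sensitive input, under ties-to-away** (`p = 4`, `|c| = ¼u⁻²η = 2^(emin+6)
= 64η`): `c' = fl(4.5η) = uc + η = 5η`, `e = uc + 2η = 6η`, and the SECOND tie `|c| − e = 58η =
M⁻(pred|c|)` is again resolved away from zero: `cinf = pred(c)`, `csup = succ(c)` (both signs of `c`).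
[cite: RumpZimmermannBoldoMelquiond2009, §2.2 (proof of Theorem 2, "Let us finally assume rounding to
nearest with 'ties to away'")] -/
theorem theorem_2_prec_four_tie_point_of_tiesAway (hfl : IsRoundNearest 4 emin fl)
    (haway : IsTiesAway 4 emin fl) {c : ℚ} (hc : |c| = (2 : ℚ) ^ (emin + 6)) :
    IsPred 4 emin c (cinf fl 4 emin c) ∧ IsSucc 4 emin c (csup fl 4 emin c) := by
  set η : ℚ := (2 : ℚ) ^ emin with hη
  have hηpos : 0 < η := two_zpow_pos' _
  have hp1 : 1 ≤ 4 := by norm_num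
  -- the floats `N·2^k·η` we meet
  have hF : ∀ (m : ℚ) (N : ℤ) (k : ℕ), |N| ≤ 16 → m = (N : ℚ) * 2 ^ k → IsFloat 4 emin (m * η) := by
    intro m N k hN hm
    have : m * η = (N : ℚ) * (2 : ℚ) ^ (emin + k) := by
      rw [hm, hη, zpow_add₀ (by norm_num : (2 : ℚ) ≠ 0), zpow_natCast]; ring
    rw [this]
    exact isFloat_of_abs_le hp1 (le_trans hN (by norm_num)) (by omega)
  have hF4 : IsFloat 4 emin (4 * η) := hF 4 4 0 (by norm_num) (by norm_num)
  have hF6 : IsFloat 4 emin (6 * η) := hF 6 6 0 (by norm_num) (by norm_num)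
  have hF56 : IsFloat 4 emin (56 * η) := hF 56 7 3 (by norm_num) (by norm_num)
  have hF60 : IsFloat 4 emin (60 * η) := hF 60 15 2 (by norm_num) (by norm_num)
  have hF64 : IsFloat 4 emin (64 * η) := hF 64 1 6 (by norm_num) (by norm_num)
  have hF72 : IsFloat 4 emin (72 * η) := hF 72 9 3 (by norm_num) (by norm_num)
  have h64 : (2 : ℚ) ^ (emin + 6) = 64 * η := by rw [hη, two_zpow_shift (emin + 6) emin 6 (by ring)]; norm_num
  have hu : unitRoundoff 4 = 1 / 16 := by rw [unitRoundoff]; norm_num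
  -- `c' = fl(φ|c|) = fl((4η + 5η)/2) = 5η`, `e = 6η`
  have hφ : phi 4 * |c| = (4 * η + 5 * η) / 2 := by rw [hc, h64, phi, hu]; ring
  have hS45 : IsSucc 4 emin (4 * η) (5 * η) := by
    have h := (isPred_sub_eta_and_isSucc_add_eta_of_abs_lt hp1 hF4
      (show |(4 : ℚ) * η| < (2 : ℚ) ^ (emin + (4 : ℕ)) by
        rw [abs_of_pos (by positivity), show (2 : ℚ) ^ (emin + (4 : ℕ)) = 2 ^ 4 * η from
          two_zpow_shift _ emin 4 (by push_cast; ring)]; linarith)).2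
    rw [← hη] at h
    convert h using 1; ring
  have hc' : fl (phi 4 * |c|) = 5 * η := by
    rw [hφ]
    exact fl_midpoint_of_tiesAway_nonneg hfl haway hF4 hS45 (by positivity)
  have he : stepE fl 4 emin c = 6 * η := by
    unfold stepE
    rw [hc', ← hη, show 5 * η + η = 6 * η by ring]
    exact fl_eq_self hfl hF6
  -- neighbours of `64η`: `pred = 60η`, `succ = 72η`; and `succ(56η) = 60η`
  have hufp64 : ufp (64 * η) = 64 * η := by rw [← h64, ufp_two_zpow]
  have hS64 : IsSucc 4 emin (64 * η) (72 * η) := by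
    have h := isSucc_add_two_u_ufp (p := 4) (emin := emin) hp1 hF64
      (by positivity) (by rw [show (2 : ℚ) ^ (emin + (4 : ℕ) - 1) = 2 ^ 3 * η from
        two_zpow_shift _ emin 3 (by push_cast; ring)]; linarith)
    rw [hufp64, hu] at h
    convert h using 1; ring
  have hP64 : IsPred 4 emin (64 * η) (60 * η) := by
    have h := isPred_two_zpow (p := 4) (emin := emin) hp1 (E := emin + 6) (by omega)
    rw [h64, show (2 : ℚ) ^ (emin + 6 - (4 : ℕ)) = 2 ^ 2 * η from two_zpow_shift _ emin 2 (by push_cast; ring)] at h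
    convert h using 1; ring
  have hS56 : IsSucc 4 emin (56 * η) (60 * η) := by
    have hufp : ufp (56 * η) = 32 * η := by
      rw [show (32 : ℚ) * η = (2 : ℚ) ^ (emin + 5) by rw [hη, two_zpow_shift (emin + 5) emin 5 (by ring)]; norm_num]
      refine ufp_eq_two_zpow_of_le_of_lt ?_ ?_
      · rw [abs_of_pos (by positivity), two_zpow_shift (emin + 5) emin 5 (by ring), ← hη]; norm_num; linarith
      · rw [abs_of_pos (by positivity), two_zpow_shift (emin + 5 + 1) emin 6 (by ring), ← hη]; norm_num; linarith
    have h := isSucc_add_two_u_ufp (p := 4) (emin := emin) hp1 hF56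
      (by positivity) (by rw [show (2 : ℚ) ^ (emin + (4 : ℕ) - 1) = 2 ^ 3 * η from
        two_zpow_shift _ emin 3 (by push_cast; ring)]; linarith)
    rw [hufp, hu] at h
    convert h using 1; ring
  unfold cinf csup
  rw [he]
  rcases (abs_eq (two_zpow_pos' (emin + 6)).le).mp hc with hpos | hneg
  · rw [hpos, h64]
    constructor
    · rw [show 64 * η - 6 * η = (56 * η + 60 * η) / 2 by ring,
        fl_midpoint_of_tiesAway_nonneg hfl haway hF56 hS56 (by positivity)]
      exact hP64
    · have hlo : 72 * η ≤ fl (64 * η + 6 * η) :=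
        le_fl_of_mid_pred_lt hfl hF72 (isPred_of_isSucc hS64 hF64) (by linarith)
      have hhi : fl (64 * η + 6 * η) ≤ 72 * η := fl_le_of_le hfl hF72 (by linarith)
      rw [le_antisymm hhi hlo]
      exact hS64
  · rw [hneg, h64]
    constructor
    · have hS' : IsSucc 4 emin (-(72 * η)) (-(64 * η)) := isSucc_neg_iff.mpr (isPred_of_isSucc hS64 hF64)
      have hhi : fl (-(64 * η) - 6 * η) ≤ -(72 * η) :=
        fl_le_of_lt_mid_succ hfl hF72.neg hS' (by linarith)
      have hlo : -(72 * η) ≤ fl (-(64 * η) - 6 * η) := le_fl_of_le hfl hF72.neg (by linarith)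
      rw [le_antisymm hhi hlo]
      exact isPred_neg_iff.mpr hS64
    · have hS' : IsSucc 4 emin (-(60 * η)) (-(56 * η)) := isSucc_neg_iff.mpr (isPred_of_isSucc hS56 hF56)
      rw [show -(64 * η) + 6 * η = (-(60 * η) + -(56 * η)) / 2 by ring,
        fl_midpoint_of_tiesAway_nonpos hfl haway hF60.neg hS' (by linarith)]
      exact isSucc_neg_iff.mpr hP64

/-- **THEOREM 2 under ties-to-away** (`u ≤ ¹⁄₁₆`), the second IEEE 754-2008 tie rule named in the
printed statement: for `p ≥ 5` nothing depends on ties (Remark 2); for `p = 4` the tie-sensitive input is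
handled by `theorem_2_prec_four_tie_point_of_tiesAway`.
[cite: RumpZimmermannBoldoMelquiond2009, §2.2 Theorem 2] -/
theorem theorem_2_tiesAway (hp : 4 ≤ p) (hfl : IsRoundNearest p emin fl) (haway : IsTiesAway p emin fl)
    {c : ℚ} (hc : IsFloat p emin c)
    (hrange : |c| < (2 : ℚ) ^ (emin + p - 1) ∨ (2 : ℚ) ^ (emin + p + 1) < |c|) :
    IsPred p emin c (cinf fl p emin c) ∧ IsSucc p emin c (csup fl p emin c) := by
  rcases hrange with hlt | hgt
  · exact theorem_2_low (by omega) hfl hc hlt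
  · by_cases h6 : p = 4 ∧ |c| = (2 : ℚ) ^ (emin + 6)
    · obtain ⟨rfl, h⟩ := h6
      exact theorem_2_prec_four_tie_point_of_tiesAway hfl haway h
    · exact theorem_2_high hp hfl (fun h4 hc6 => absurd ⟨h4, hc6⟩ h6) hc hgt

/-! ### §2.2 Algorithm 2 and Theorem 3: the exact neighbours everywhere (binary, `u ≤ ¹⁄₁₆`) -/

/-- The step of the "if"-branch of Algorithm 2: `e = fl(φ|c|)` (no `η` term).
[cite: RumpZimmermannBoldoMelquiond2009, §2.2 Algorithm 2] -/
def stepE2 (fl : ℚ → ℚ) (p : ℕ) (c : ℚ) : ℚ := fl (phi p * |c|)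

/-- The scaled input of the "else"-branch of Algorithm 2: `C = fl(u⁻¹c)`.
[cite: RumpZimmermannBoldoMelquiond2009, §2.2 Algorithm 2] -/
def scaleC (fl : ℚ → ℚ) (p : ℕ) (c : ℚ) : ℚ := fl ((unitRoundoff p)⁻¹ * c)

/-- **ALGORITHM 2** ("Computation of the predecessor and successor of finite `c ∈ F` in binary arithmetic
with rounding to nearest"), returning `(cinf, csup)`:
`if |c| ≥ ½u⁻²η: e = fl(φ|c|), (fl(c − e), fl(c + e))`;
`elseif |c| < u⁻¹η: (fl(c − η), fl(c + η))`;
`else: C = fl(u⁻¹c), e = fl(φ|C|), (fl(fl(C − e)·u), fl(fl(C + e)·u))`.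
[cite: RumpZimmermannBoldoMelquiond2009, §2.2 Algorithm 2] -/
def algorithm2 (fl : ℚ → ℚ) (p : ℕ) (emin : ℤ) (c : ℚ) : ℚ × ℚ :=
  if (2 : ℚ) ^ (emin + 2 * p - 1) ≤ |c| then
    (fl (c - stepE2 fl p c), fl (c + stepE2 fl p c))
  else if |c| < (2 : ℚ) ^ (emin + p) then
    (fl (c - (2 : ℚ) ^ emin), fl (c + (2 : ℚ) ^ emin))
  else
    (fl (fl (scaleC fl p c - stepE2 fl p (scaleC fl p c)) * unitRoundoff p),
      fl (fl (scaleC fl p c + stepE2 fl p (scaleC fl p c)) * unitRoundoff p))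

/-- The core of Theorem 1 for an arbitrary step: if `e > u·ufp(c)` and `c` is normal, then
`fl(c − e) ≤ pred(c)` and `succ(c) ≤ fl(c + e)` ((9), (10): `c − e < M⁻(c)`, `M⁺(c) < c + e`).
[cite: RumpZimmermannBoldoMelquiond2009, §2 eqs. (9)–(10); §2.1 (16)–(17); §2.2 (proof of Theorem 3,
"if"-clause, last step)] -/
theorem fl_sub_le_pred_and_succ_le_fl_add (hp : 1 ≤ p) (hfl : IsRoundNearest p emin fl) {c : ℚ}
    (hc : IsFloat p emin c) (hU : (2 : ℚ) ^ (emin + p - 1) < |c|) {e : ℚ}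
    (he : unitRoundoff p * ufp c < e) {cp cs : ℚ} (hcp : IsPred p emin c cp) (hcs : IsSucc p emin c cs) :
    fl (c - e) ≤ cp ∧ cs ≤ fl (c + e) := by
  obtain ⟨hlo, -, hhi⟩ := pred_succ_within_two_u_ufp hp hc hU hcp hcs
  exact ⟨fl_le_of_lt_mid_succ hfl hcp.1 (isSucc_of_isPred hcp hc) (by linarith),
    le_fl_of_mid_pred_lt hfl hcs.1 (isPred_of_isSucc hcs hc) (by linarith)⟩

/-- Scaling by `u = 2^-p` is exact far enough from underflow: `x ∈ F`, `|x| ≥ ½u⁻²η` imply `u·x ∈ F`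
("where the final multiplication by `u` is exact too").
[cite: RumpZimmermannBoldoMelquiond2009, §2.2 (proof of Theorem 3, "else"-clause)] -/
theorem isFloat_div_two_pow {x : ℚ} (hx : IsFloat p emin x) (hge : (2 : ℚ) ^ (emin + 2 * p - 1) ≤ |x|) :
    IsFloat p emin (x / 2 ^ p) := by
  obtain ⟨M, e, hM, he, rfl⟩ := hx
  have hMQ : |(M : ℚ)| < (2 : ℚ) ^ p := by exact_mod_cast hM
  have h2e := two_zpow_pos' e
  have h1 : (2 : ℚ) ^ (emin + 2 * p - 1) < (2 : ℚ) ^ (e + p) := by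
    calc (2 : ℚ) ^ (emin + 2 * p - 1) ≤ |(M : ℚ) * (2 : ℚ) ^ e| := hge
      _ = |(M : ℚ)| * (2 : ℚ) ^ e := by rw [abs_mul, abs_of_pos h2e]
      _ < (2 : ℚ) ^ p * (2 : ℚ) ^ e := mul_lt_mul_of_pos_right hMQ h2e
      _ = (2 : ℚ) ^ (e + p) := by rw [zpow_add₀ (by norm_num : (2 : ℚ) ≠ 0), zpow_natCast, mul_comm]
  have h2 := two_zpow_lt_two_zpow_iff.mp h1
  refine ⟨M, e - p, hM, by omega, ?_⟩
  rw [zpow_sub₀ (by norm_num : (2 : ℚ) ≠ 0), zpow_natCast]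
  field_simp

/-- `x·u = x/2^p`. [folklore] -/
private theorem mul_u_eq_div (x : ℚ) : x * unitRoundoff p = x / 2 ^ p := by rw [unitRoundoff]; ring

/-- `pred` of a float `C` with `|C| ≥ 2^(K+1)` still has `|pred(C)| ≥ 2^K` (`K ≥ emin`). [folklore] -/
private theorem two_zpow_le_abs_of_isPred (hp : 1 ≤ p) {C G : ℚ} {K : ℤ} (hK : emin ≤ K)
    (hCU : (2 : ℚ) ^ (K + 1) ≤ |C|) (hG : IsPred p emin C G) : (2 : ℚ) ^ K ≤ |G| := by
  have hKK : (2 : ℚ) ^ K ≤ (2 : ℚ) ^ (K + 1) := two_zpow_le_two_zpow (by omega)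
  have hC0 : C ≠ 0 := by rintro rfl; simp at hCU; linarith [two_zpow_pos' (K + 1)]
  rcases lt_or_gt_of_ne hC0 with hneg | hpos
  · rw [abs_of_neg hneg] at hCU
    have : G < C := hG.2.1
    rw [abs_of_neg (by linarith)]; linarith
  · rw [abs_of_pos hpos] at hCU
    have hlt : (2 : ℚ) ^ K < C := lt_of_lt_of_le (two_zpow_lt_two_zpow_iff.mpr (by omega)) hCU
    have := hG.2.2 _ (isFloat_two_zpow hp hK) hlt
    rwa [abs_of_pos (lt_of_lt_of_le (two_zpow_pos' K) this)]

/-- Same for `succ`, by the symmetry `succ(C) = −pred(−C)`. [folklore] -/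
private theorem two_zpow_le_abs_of_isSucc (hp : 1 ≤ p) {C G : ℚ} {K : ℤ} (hK : emin ≤ K)
    (hCU : (2 : ℚ) ^ (K + 1) ≤ |C|) (hG : IsSucc p emin C G) : (2 : ℚ) ^ K ≤ |G| := by
  have := two_zpow_le_abs_of_isPred hp hK (by rwa [abs_neg]) (isPred_neg_iff.mpr hG)
  rwa [abs_neg] at this

/-- Unscaling a predecessor: `pred(2^p·c)/2^p = pred(c)` as soon as the quotient is a float.
[cite: RumpZimmermannBoldoMelquiond2009, §2.2 (proof of Theorem 3, "else"-clause: "the code is similar to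
the one in the 'if'-clause applied to a scaled `c`")] -/
theorem isPred_div_two_pow {c G : ℚ} (hG : IsPred p emin (2 ^ p * c) G) (hGF : IsFloat p emin (G / 2 ^ p)) :
    IsPred p emin c (G / 2 ^ p) := by
  have h2p : (0 : ℚ) < 2 ^ p := by positivity
  refine ⟨hGF, ?_, fun h hh hlt => ?_⟩
  · rw [div_lt_iff₀ h2p]; linarith [hG.2.1]
  · rw [le_div_iff₀ h2p]
    have := hG.2.2 (2 ^ p * h) (isFloat_two_pow_mul hh) (by nlinarith)
    linarith

/-- Unscaling a successor: `succ(2^p·c)/2^p = succ(c)` as soon as the quotient is a float.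
[cite: RumpZimmermannBoldoMelquiond2009, §2.2 (proof of Theorem 3, "else"-clause: "the code is similar to the one in the 'if'-clause applied to a scaled `c`")] -/
theorem isSucc_div_two_pow {c G : ℚ} (hG : IsSucc p emin (2 ^ p * c) G) (hGF : IsFloat p emin (G / 2 ^ p)) :
    IsSucc p emin c (G / 2 ^ p) := by
  have h2p : (0 : ℚ) < 2 ^ p := by positivity
  refine ⟨hGF, ?_, fun h hh hlt => ?_⟩
  · rw [lt_div_iff₀ h2p]; linarith [hG.2.1]
  · rw [div_le_iff₀ h2p]
    have := hG.2.2 (2 ^ p * h) (isFloat_two_pow_mul hh) (by nlinarith)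
    linarith

/-- **THEOREM 3, "if"-clause**: for `|c| ≥ ½u⁻²η` and `u ≤ ¹⁄₁₆`, with `e = fl(φ|c|)` one has
`fl(c − e) = pred(c)` and `fl(c + e) = succ(c)` — from `e ≤ e'` (Algorithm 1's step, monotonicity (2)),
Theorem 2 for Algorithm 1, and `e ≥ fl(u·succ|c|) = u·succ|c| > u·ufp(c)` with (9), (10); any tie rule.
[cite: RumpZimmermannBoldoMelquiond2009, §2.2 Theorem 3 (proof, "if"-clause)] -/
theorem theorem_3_if (hp : 4 ≤ p) (hfl : IsRoundNearest p emin fl) {c : ℚ} (hc : IsFloat p emin c)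
    (h1 : (2 : ℚ) ^ (emin + 2 * p - 1) ≤ |c|) :
    IsPred p emin c (fl (c - stepE2 fl p c)) ∧ IsSucc p emin c (fl (c + stepE2 fl p c)) := by
  have hp1 : 1 ≤ p := by omega
  have hc0 : c ≠ 0 := by rintro rfl; simp at h1; linarith [two_zpow_pos' (emin + 2 * p - 1)]
  have haU : (2 : ℚ) ^ (emin + p - 1) ≤ |c| := (two_zpow_le_two_zpow (by omega)).trans h1
  have haU' : (2 : ℚ) ^ (emin + p - 1) < |c| := lt_of_lt_of_le (two_zpow_lt_two_zpow_iff.mpr (by omega)) h1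
  -- Theorem 2 for Algorithm 1 at `c`, and `e ≤ e'`
  obtain ⟨hpred', hsucc'⟩ := theorem_2_high_of_le hp hfl hc h1
  have hee' : stepE2 fl p c ≤ stepE fl p emin c := fl_phi_le_stepE hfl c
  have hlo1 : cinf fl p emin c ≤ fl (c - stepE2 fl p c) := fl_mono hfl (by linarith)
  have hhi1 : fl (c + stepE2 fl p c) ≤ csup fl p emin c := fl_mono hfl (by linarith)
  -- `e ≥ fl(u·succ|c|) = u·succ|c| > u·ufp(c)`
  have haF : IsFloat p emin |c| := isFloat_abs hc
  obtain ⟨S, hS⟩ := exists_isSucc hp1 haF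
  have hS' := isSucc_add_two_u_ufp hp1 haF (abs_pos.mpr hc0) haU
  rw [ufp_abs] at hS'
  have hSeq : S = |c| + 2 * unitRoundoff p * ufp c := hS.unique hS'
  have hupos : 0 < unitRoundoff p := u_pos
  have hufp := ufp_le_abs c
  have hSbig : (2 : ℚ) ^ (emin + 2 * p - 1) ≤ |S| := by
    rw [abs_of_pos (lt_trans (abs_pos.mpr hc0) hS.2.1)]; exact h1.trans hS.2.1.le
  have hSF : IsFloat p emin (unitRoundoff p * S) := by
    rw [mul_comm, mul_u_eq_div]; exact isFloat_div_two_pow hS.1 hSbig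
  have huS : unitRoundoff p * S ≤ phi p * |c| := by
    rw [hSeq, phi]
    have := mul_le_mul_of_nonneg_left hufp (mul_pos two_pos hupos).le
    nlinarith
  have he : unitRoundoff p * ufp c < stepE2 fl p c := by
    have hm : fl (unitRoundoff p * S) ≤ stepE2 fl p c := fl_mono hfl huS
    rw [fl_eq_self hfl hSF] at hm
    have : ufp c < S := lt_of_le_of_lt hufp hS.2.1
    nlinarith
  obtain ⟨hlo2, hhi2⟩ := fl_sub_le_pred_and_succ_le_fl_add hp1 hfl hc haU' he hpred' hsucc'
  rw [le_antisymm hlo2 hlo1, le_antisymm hhi1 hhi2]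
  exact ⟨hpred', hsucc'⟩

/-- **THEOREM 3.** For every `c ∈ F` (binary, `u ≤ ¹⁄₁₆`; no overflow in this model) Algorithm 2
returns exactly `cinf = pred(c)` and `csup = succ(c)` — for ANY rounding to nearest (no tie hypothesis:
the "if"-clause starts at `½u⁻²η`, above the tie-sensitive input of Theorem 2; the "elseif"-clause is (8);
in the "else"-clause `C = fl(u⁻¹c) = u⁻¹c`, `|C| ≥ u⁻²η`, and the final multiplication by `u` is exact).
[cite: RumpZimmermannBoldoMelquiond2009, §2.2 Algorithm 2, Theorem 3] -/
theorem theorem_3 (hp : 4 ≤ p) (hfl : IsRoundNearest p emin fl) {c : ℚ} (hc : IsFloat p emin c) :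
    IsPred p emin c (algorithm2 fl p emin c).1 ∧ IsSucc p emin c (algorithm2 fl p emin c).2 := by
  have hp1 : 1 ≤ p := by omega
  unfold algorithm2
  split_ifs with h1 h2
  · exact theorem_3_if hp hfl hc h1
  · -- "elseif": `c ∈ U`, (8)
    have h8 := isPred_sub_eta_and_isSucc_add_eta_of_abs_lt hp1 hc h2
    dsimp only
    rw [fl_eq_self hfl h8.1.1, fl_eq_self hfl h8.2.1]
    exact h8
  · -- "else": `u⁻¹η ≤ |c| < ½u⁻²η`, scale by `u⁻¹ = 2^p` and back
    push Not at h1 h2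
    have hC : scaleC fl p c = 2 ^ p * c := by unfold scaleC; rw [inv_u]; exact fl_two_pow_mul hfl hc
    simp only [hC]
    have hCF : IsFloat p emin (2 ^ p * c) := isFloat_two_pow_mul hc
    have hCU : (2 : ℚ) ^ (emin + 2 * p - 1 + 1) ≤ |(2 : ℚ) ^ p * c| := by
      rw [abs_mul, abs_of_pos (by positivity), ← zpow_natCast,
        show emin + 2 * (p : ℤ) - 1 + 1 = (p : ℤ) + (emin + p) by ring, zpow_add₀ (by norm_num : (2 : ℚ) ≠ 0)]
      exact mul_le_mul_of_nonneg_left h2 (two_zpow_pos' _).le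
    obtain ⟨hG1, hG2⟩ := theorem_3_if hp hfl hCF
      ((two_zpow_le_two_zpow (by omega)).trans hCU)
    have hK : emin ≤ emin + 2 * p - 1 := by omega
    have hGmF := isFloat_div_two_pow hG1.1 (two_zpow_le_abs_of_isPred hp1 hK hCU hG1)
    have hGpF := isFloat_div_two_pow hG2.1 (two_zpow_le_abs_of_isSucc hp1 hK hCU hG2)
    rw [mul_u_eq_div, mul_u_eq_div, fl_eq_self hfl hGmF, fl_eq_self hfl hGpF]
    exact ⟨isPred_div_two_pow hG1 hGmF, isSucc_div_two_pow hG2 hGpF⟩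

/-! ### §2.2 eq. (22): rigorous bounds for `a ∘ b` -/

/-- `pred(fl(x)) < x`: otherwise `pred(fl(x)) ∈ F` would be nearer to `x` than `fl(x)`.
[cite: RumpZimmermannBoldoMelquiond2009, §2.2 eq. (22) (its content: `fl(x)` is a nearest float, so `pred(fl x) < x`)] -/
theorem pred_fl_lt (hfl : IsRoundNearest p emin fl) {x cp : ℚ} (hcp : IsPred p emin (fl x) cp) : cp < x := by
  by_contra h
  push Not at h
  have h1 := (hfl x).2 cp hcp.1
  have h2 : cp < fl x := hcp.2.1
  rw [abs_of_nonpos (by linarith), abs_of_nonpos (by linarith)] at h1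
  linarith

/-- `x < succ(fl(x))`.
[cite: RumpZimmermannBoldoMelquiond2009, §2.2 eq. (22) (`x < succ(fl x)`)] -/
theorem lt_succ_fl (hfl : IsRoundNearest p emin fl) {x cs : ℚ} (hcs : IsSucc p emin (fl x) cs) : x < cs := by
  by_contra h
  push Not at h
  have h1 := (hfl x).2 cs hcs.1
  have h2 : fl x < cs := hcs.2.1
  rw [abs_of_nonneg (by linarith), abs_of_nonneg (by linarith)] at h1
  linarith

/-- **(22) for Algorithm 1**: if `c = fl(x)` (e.g. `x = a ∘ b`, `∘ ∈ {+, −, ×, ÷}`, or `√a`), then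
`cinf ≤ x ≤ csup` — indeed strictly, `cinf ≤ pred(c) < x < succ(c) ≤ csup` (`p ≥ 2`, any tie rule).
[cite: RumpZimmermannBoldoMelquiond2009, §2.2 eq. (22); §2.2 ("rigorous and mostly sharp bounds for
`a ∘ b` … by applying Algorithm 1 to `c := fl(a ∘ b)`. This holds for the square root as well.")] -/
theorem enclosure_algorithm1 (hp : 2 ≤ p) (hfl : IsRoundNearest p emin fl) (x : ℚ) :
    cinf fl p emin (fl x) < x ∧ x < csup fl p emin (fl x) := by
  have hp1 : 1 ≤ p := by omega
  obtain ⟨cp, hcp⟩ := exists_isPred hp1 (hfl x).1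
  obtain ⟨cs, hcs⟩ := exists_isSucc hp1 (hfl x).1
  obtain ⟨h1, h2⟩ := theorem_1 hp hfl (hfl x).1 hcp hcs
  exact ⟨lt_of_le_of_lt h1 (pred_fl_lt hfl hcp), lt_of_lt_of_le (lt_succ_fl hfl hcs) h2⟩

/-- **(22) for Algorithm 2** (`u ≤ ¹⁄₁₆`): `cinf = pred(fl x) < x < succ(fl x) = csup`.
[cite: RumpZimmermannBoldoMelquiond2009, §2.2 eq. (22)] -/
theorem enclosure_algorithm2 (hp : 4 ≤ p) (hfl : IsRoundNearest p emin fl) (x : ℚ) :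
    (algorithm2 fl p emin (fl x)).1 < x ∧ x < (algorithm2 fl p emin (fl x)).2 := by
  obtain ⟨h1, h2⟩ := theorem_3 hp hfl (hfl x).1
  exact ⟨pred_fl_lt hfl h1, lt_succ_fl hfl h2⟩

/-! ### Sharpness of `u ≤ ¹⁄₁₆` in Theorem 2 -/

/-- **Theorem 2 fails for `u = ⅛`** (`p = 3`, ties-to-even, `emin = −5`): at `c = 1` — well outside
`[½u⁻¹η, 2u⁻¹η] = [⅛, ½]` — Algorithm 1 computes `φc = 5/32`, `e = fl(5/32 + 1/32) = 3/16`,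
`cinf = RN_e(13/16) = 3/4` (a tie, to even) `< pred(1) = 7/8`, while `csup = RN_e(19/16) = 5/4 = succ(1)`.
So Theorem 1's inequality is strict here and the hypothesis `u ≤ ¹⁄₁₆` of Theorem 2 cannot be relaxed to
`u ≤ ⅛` — the paper's own witness ("This is seen by `u = ⅛`, `η = ¹⁄₃₂` and `c = 1 ∉ [½, 2]u⁻¹η =
[⅛, ½]`"), here with ties to even and the intermediate values decided.
[cite: RumpZimmermannBoldoMelquiond2009, §2.2 (closing paragraph of the proof of Theorem 2)] -/
theorem theorem_2_fails_prec_three :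
    algorithm1 (roundTiesEven 3 (-5)) 3 (-5) 1 = (3 / 4, 5 / 4) ∧
      IsPred 3 (-5) 1 (7 / 8) ∧ IsSucc 3 (-5) 1 (5 / 4) ∧ (3 / 4 : ℚ) ≠ 7 / 8 := by
  have hrn : IsRoundNearest 3 (-5) (roundTiesEven 3 (-5)) := isRoundNearest_roundTiesEven (by norm_num)
  have hu : unitRoundoff 3 = 1 / 8 := by rw [unitRoundoff]; norm_num
  have hφ : phi 3 = 5 / 32 := by rw [phi, hu]; norm_num
  -- the exact intermediate values
  have hF532 : IsFloat 3 (-5) (5 / 32 : ℚ) := by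
    rw [show (5 / 32 : ℚ) = ((5 : ℤ) : ℚ) * (2 : ℚ) ^ (-5 : ℤ) by norm_num]
    exact isFloat_of_abs_le (by norm_num) (by norm_num) le_rfl
  have hF316 : IsFloat 3 (-5) (3 / 16 : ℚ) := by
    rw [show (3 / 16 : ℚ) = ((6 : ℤ) : ℚ) * (2 : ℚ) ^ (-5 : ℤ) by norm_num]
    exact isFloat_of_abs_le (by norm_num) (by norm_num) le_rfl
  have he : stepE (roundTiesEven 3 (-5)) 3 (-5) 1 = 3 / 16 := by
    unfold stepE
    rw [hφ, abs_one, mul_one, fl_eq_self hrn hF532, show (5 / 32 : ℚ) + (2 : ℚ) ^ (-5 : ℤ) = 3 / 16 by norm_num]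
    exact fl_eq_self hrn hF316
  -- `RN_e(13/16) = 3/4`: `ulp(13/16) = 1/8`, `⌊6.5⌋ = 6` even, a tie
  have hlog1 : Int.log 2 |(13 / 16 : ℚ)| = -1 := by
    rw [show |(13 / 16 : ℚ)| = 13 / 16 by norm_num]
    have h1 : ((2 : ℕ) : ℚ) ^ (-1 : ℤ) ≤ 13 / 16 := by norm_num
    have h2 : (13 / 16 : ℚ) < ((2 : ℕ) : ℚ) ^ ((-1 : ℤ) + 1) := by norm_num
    have hlo := (Int.zpow_le_iff_le_log (b := 2) (by norm_num) (by norm_num : (0 : ℚ) < 13 / 16)).mp h1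
    have hhi := (Int.lt_zpow_iff_log_lt (b := 2) (by norm_num) (by norm_num : (0 : ℚ) < 13 / 16)).mp h2
    omega
  have hulp1 : ulp 3 (-5) (13 / 16 : ℚ) = 1 / 8 := by
    rw [ulp_of_ne_zero (by norm_num), hlog1, max_eq_right (by norm_num)]; norm_num
  have hfloor1 : ⌊(13 / 16 : ℚ) / ulp 3 (-5) (13 / 16 : ℚ)⌋ = 6 := by
    rw [hulp1, Int.floor_eq_iff]; norm_num
  have htie : (13 / 16 : ℚ) - (⌊(13 / 16 : ℚ) / ulp 3 (-5) (13 / 16 : ℚ)⌋ : ℚ) * ulp 3 (-5) (13 / 16 : ℚ) =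
      ((⌊(13 / 16 : ℚ) / ulp 3 (-5) (13 / 16 : ℚ)⌋ : ℚ) + 1) * ulp 3 (-5) (13 / 16 : ℚ) - 13 / 16 := by
    rw [hfloor1, hulp1]; norm_num
  have hcinf : roundTiesEven 3 (-5) (13 / 16 : ℚ) = 3 / 4 := by
    rw [roundTiesEven_of_tie htie, hfloor1, if_pos (by decide), hulp1]; norm_num
  -- `RN_e(19/16) = 5/4`: `ulp(19/16) = 1/4`, `⌊4.75⌋ = 4`, nearer to `5·¼`
  have hlog2 : Int.log 2 |(19 / 16 : ℚ)| = 0 := by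
    rw [show |(19 / 16 : ℚ)| = 19 / 16 by norm_num]
    have h1 : ((2 : ℕ) : ℚ) ^ (0 : ℤ) ≤ 19 / 16 := by norm_num
    have h2 : (19 / 16 : ℚ) < ((2 : ℕ) : ℚ) ^ ((0 : ℤ) + 1) := by norm_num
    have hlo := (Int.zpow_le_iff_le_log (b := 2) (by norm_num) (by norm_num : (0 : ℚ) < 19 / 16)).mp h1
    have hhi := (Int.lt_zpow_iff_log_lt (b := 2) (by norm_num) (by norm_num : (0 : ℚ) < 19 / 16)).mp h2
    omega
  have hulp2 : ulp 3 (-5) (19 / 16 : ℚ) = 1 / 4 := by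
    rw [ulp_of_ne_zero (by norm_num), hlog2, max_eq_right (by norm_num)]; norm_num
  have hfloor2 : ⌊(19 / 16 : ℚ) / ulp 3 (-5) (19 / 16 : ℚ)⌋ = 4 := by
    rw [hulp2, Int.floor_eq_iff]; norm_num
  have hcsup : roundTiesEven 3 (-5) (19 / 16 : ℚ) = 5 / 4 := by
    unfold roundTiesEven
    rw [hfloor2, hulp2]; norm_num
  refine ⟨?_, ?_, ?_, by norm_num⟩
  · unfold algorithm1 cinf csup
    rw [he, show (1 : ℚ) - 3 / 16 = 13 / 16 by norm_num, show (1 : ℚ) + 3 / 16 = 19 / 16 by norm_num,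
      hcinf, hcsup]
  · have h := isPred_two_zpow (p := 3) (emin := -5) (by norm_num) (E := 0) (by norm_num)
    norm_num at h
    exact h
  · have h := isSucc_add_two_u_ufp (p := 3) (emin := -5) (by norm_num) (f := 1)
      (by simpa using isFloat_two_zpow (p := 3) (emin := -5) (by norm_num) (k := 0) (by norm_num))
      one_pos (by norm_num)
    rw [hu, show ufp (1 : ℚ) = 1 by simpa using ufp_two_zpow 0] at h
    norm_num at h
    exact h

end Literature.ComputerArithmetic.RumpZimmermannBoldoMelquiond2009
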